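import Literature.MathematicalPhysics.QuantumFieldTheory.Balaban1983to89.B1Eq324BenfattoTwoStageLaw
import Literature.MathematicalPhysics.QuantumFieldTheory.Balaban1983to89.B1Eq324BenfattoSect5PavementStep
import HarnessLib

/-!
# `Balaban1983to89.B1Eq324BenfattoSect5Eq536` — [BenfattoEtAl1978] §5 p. 159, (5.36): (5.13) UNDER THE CONDITIONED MEASURE `P̄ = P̂₀(·|z̄_C)` —
# the factorisation identity for the product over boxes with outer measure `condField C z̄` and inner measure `P̂₀(·|ξ_{C∪Γ₁})`, PROVED for the
# tree's objects (the structural input of the upper bound (4.6) with a conditioning set `C ≠ ∅`)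

statement-level skeleton of published theorems with citation tags; proofs where landed; nothing here is a claim about the
Yang–Mills mass gap

WHY THIS MODULE (cell `pub-ymgap`, seat `dag-n08-d` gen 9, INTENT-37; node N08 [Balaban1985UV3]; the [BenfattoEtAl1978] source chain behind the
(α)-row `h324c`).  Print, p. 159 (render `lit-balaban-typer/renders/benfatto1978-cmp59/bcg_p159_s3.png`, read first-hand): *"The inequality (4.6) is
obtained by simple modifications of (4.7). We start from (5.13), then assuming |z_Δ| ≦ b(1 + d(Δ, I)), ∀Δ ∈ C: [(5.12)] ≦ ∫P̄(dz_{Γ₁})χ^{Γ₁}_b exp H_{Γ₁}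
(Π_{□∩J=∅}∫P̄(dz_□|z_{Γ₁})χ^□_b)·(Π_{□∩J≠∅}∫P̄(dz_□|z_{Γ₁}) exp Ψ_□χ^□_b) (5.36)"*.  Here `P̄ = P̂₀(·|(z̄_Δ)_{Δ∈C})` (p. 152) and `P̄(dz_□|z_{Γ₁})`
conditions it FURTHER on the corridor variables: in the tree's regression dictionary this is `condField (C ∪ Γ₁) ξ` by the two-stage conditioning
(`…TwoStageLaw.integral_condField_eq_integral_condField_union`).  `…Sect5Eq515` proved (5.13) as an identity under `P̂₀` (C = ∅); this file proves
the same identity under `P̄`: outer measure `condField C z̄`, inner measure `condField (C ∪ Γ₁) ξ`, the box fields conditionally independent given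
`z_{C∪Γ₁}` (`…Markov.iIndepFun_condField_of_enclosed` for the conditioning set `C ∪ Γ₁`, on the blocks with the `C`-sites removed).

WHAT IS PROVED (standard axioms; no `sorry`; no definition).
* §1 ★★ `integral_condField_prefactor_mul_prod_eq₂` — for finite `C ⊆ S` (print: `S = C ∪ Γ₁`), pairwise disjoint `S`-enclosed regions `Ω_i` off `S`,
  a bounded measurable prefactor `h(z|_S)` and bounded jointly measurable observables `f_i(z|_S, z|_{Ω_i})`:
  `∫ h(z|_S)·Π_i f_i(z|_S, z|_{Ω_i}) dP̂₀(·|z̄_C) = ∫ h(ξ|_S)·Π_i[∫ f_i(ξ|_S, z|_{Ω_i}) dP̂₀(·|ξ_S)] dP̂₀(·|z̄_C)(ξ)`.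
* §2 ★★ `integral_boxes_factorise_eq_cond` — the (5.13)/(5.36) identity for the product over boxes under `P̄ = condField C z̄`, for ANY per-box weights
  `W_□` reading `□` only (inner measure `condField (C ∪ corridors L w B) ξ`), `C` arbitrary (its sites inside the far region / the boxes are
  conditioned, not integrated).
* §3 `integrable_boxes_integrand_of` (any finite measure), `boxFactor_eq_setIntegral_cond`, ★★★ `upperPavementStep_cond_of_setIntegral` — the (5.36)
  chain under `P̄` with all cut-offs at threshold `b` (the case `γ = 1`).
* §4 (v1.1) `indicator_smallFieldSet_le_prod_gamma`, ★★★ `upperPavementStep_cond_of_setIntegral_gamma` — the (5.36) chain with print's `γ`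
  («b replaced by γ⁻¹b»): input cut-offs at `γb`, box interiors and output at `b`; its per-box hypotheses are EXACTLY the 5th conjunct of the per-box
  line's `…Sect5PerBoxOnData.perBox_condField` at its `(b, γ)` — the version to use for (4.6) (`C = ∅` is `P̂₀` by `condField_empty`).
HONEST SCOPE.  Structural; the per-box UPPER bounds under `P̂₀(·|ξ_{C∪Γ₁})` for `C ≠ ∅` (App. C Lemma 2 with the far set `C` at distance `b³`), the
cumulant identification and the constants are not here; count-neutral for N08; `BasicLemmaPrinted` NOT discharged; nothing about d = 4, the
continuum, OS axioms, a mass gap or the Clay problem.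
-/

noncomputable section

open Finset MeasureTheory
open scoped BigOperators

namespace Literature.MathematicalPhysics.QuantumFieldTheory.Balaban1983to89.B1Eq324BenfattoSect5Eq536

open _root_.MeasureTheory _root_.ProbabilityTheory
open Literature.MathematicalPhysics.QuantumFieldTheory.Balaban1983to89.B3Sect3VectorSelfEnergy (ZSite unitVec)
open Literature.MathematicalPhysics.QuantumFieldTheory.Balaban1983to89.B1Eq324BenfattoLemma
open Literature.MathematicalPhysics.QuantumFieldTheory.Balaban1983to89.B1Eq324BenfattoSect5Boxes
open Literature.MathematicalPhysics.QuantumFieldTheory.Balaban1983to89.B1Eq324BenfattoSect5Eq511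
open Literature.MathematicalPhysics.QuantumFieldTheory.Balaban1983to89.B1Eq324BenfattoSect5Eq524
open Literature.MathematicalPhysics.QuantumFieldTheory.Balaban1983to89.B1Eq324BenfattoSect5Eq534
open Literature.MathematicalPhysics.QuantumFieldTheory.Balaban1983to89.B1Eq324BenfattoSect5Eq515
open Literature.MathematicalPhysics.QuantumFieldTheory.Balaban1983to89.B1Eq324BenfattoAppendixC2
open Literature.MathematicalPhysics.QuantumFieldTheory.Balaban1983to89.B1Eq324BenfattoAppendixCLemma2
open Literature.MathematicalPhysics.QuantumFieldTheory.Balaban1983to89.B1Eq324BenfattoMarkov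
open Literature.MathematicalPhysics.QuantumFieldTheory.Balaban1983to89.B1Eq324BenfattoTwoStageLaw
open Literature.MathematicalPhysics.QuantumFieldTheory.Balaban1983to89.B1Eq324BenfattoSect5Eq535
open Literature.MathematicalPhysics.QuantumFieldTheory.Balaban1983to89.B1Eq324BenfattoSect5Iteration
open Literature.MathematicalPhysics.QuantumFieldTheory.Balaban1983to89.B1Eq324BenfattoSect5PavementStep
open Literature.MathematicalPhysics.QuantumFieldTheory.Balaban1983to89.B1Eq324BenfattoSect5SlotMoments (distToRegion_eq_zero_of_mem)

variable {d : ℕ} {α β : ℝ}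

/-! ## §1  (5.13) with conditioning-dependent observables under `P̄ = P̂₀(·|z̄_C)` -/

section Factorisation

/-- **(5.13) UNDER `P̄ = P̂₀(·|z̄_C)` WITH CONDITIONING-DEPENDENT OBSERVABLES**: for a finite set `S` (print: `S = C ∪ Γ₁`), finitely many pairwise
disjoint `S`-enclosed regions `Ω_i` off `S`, a bounded measurable prefactor `h(z|_S)`, bounded jointly measurable observables `f_i(z|_S, z|_{Ω_i})`,
and a conditioning set `C ⊆ S`:
`∫ h(z|_S)·Π_i f_i(z|_S, z|_{Ω_i}) dP̂₀(·|z̄_C)(z) = ∫ h(ξ|_S)·Π_i [∫ f_i(ξ|_S, z|_{Ω_i}) dP̂₀(·|ξ_S)(z)] dP̂₀(·|z̄_C)(ξ)` — two-stage disintegration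
(`…TwoStageLaw`), `z|_S = ξ|_S` a.s. under `P̂₀(·|ξ_S)` (`…Sect5Eq515.condField_ae_eqOn`), and the Markov independence of the `Ω_i`-fields given `z_S`.
[cite: BenfattoEtAl1978, §5 (5.13) p.155, (5.36) p.159] -/
theorem integral_condField_prefactor_mul_prod_eq₂ (hα : 0 < α) (hβ : 0 < β) (C S : Finset (B1Eq324BenfattoLemma.Site d)) (hCS : C ⊆ S)
    (zbar : B1Eq324BenfattoLemma.Site d → ℝ) {ι : Type*} [Fintype ι]
    {Ω : ι → Set (B1Eq324BenfattoLemma.Site d)} (hΩS : ∀ i, ∀ z ∈ Ω i, z ∉ S)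
    (hΩ : ∀ i, ∀ z ∈ Ω i, ∀ μ : Fin d,
      (z + unitVec μ ∈ Ω i ∨ z + unitVec μ ∈ S) ∧ (z - unitVec μ ∈ Ω i ∨ z - unitVec μ ∈ S))
    (hdisj : ∀ i j, i ≠ j → Disjoint (Ω i) (Ω j))
    (h : (S → ℝ) → ℝ) (hh : Measurable h) {Mh : ℝ} (hMh : ∀ y, |h y| ≤ Mh)
    (f : (i : ι) → (S → ℝ) × ((Ω i) → ℝ) → ℝ) (hf : ∀ i, Measurable (f i)) {M : ι → ℝ} (hM : ∀ i q, |f i q| ≤ M i) :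
    ∫ z, h (S.restrict z) * ∏ i, f i (S.restrict z, fun t : Ω i => z t) ∂condField d α β C zbar
      = ∫ ξ, h (S.restrict ξ) * ∏ i, (∫ z, f i (S.restrict ξ, fun t : Ω i => z t) ∂condField d α β S ξ) ∂condField d α β C zbar := by
  have hXm : ∀ i, Measurable fun (z : B1Eq324BenfattoLemma.Site d → ℝ) (t : Ω i) => z t :=
    fun i => measurable_pi_lambda _ fun t => measurable_pi_apply _
  have hresS : Measurable fun z : B1Eq324BenfattoLemma.Site d → ℝ => S.restrict z := Finset.measurable_restrict S
  have hSsplit : C ∪ (S \ C) = S := Finset.union_sdiff_of_subset hCS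
  -- the bounded measurable integrand, as a function of `z` alone (the first slot of the two-stage lemma is not used)
  set G : (B1Eq324BenfattoLemma.Site d → ℝ) → ℝ := fun z => h (S.restrict z) * ∏ i, f i (S.restrict z, fun t : Ω i => z t) with hG
  have hGm : Measurable G :=
    (hh.comp hresS).mul (Finset.measurable_prod _ fun i _ => (hf i).comp (hresS.prodMk (hXm i)))
  have hGb : ∀ z, |G z| ≤ Mh * ∏ i, M i := by
    intro z
    simp only [hG]
    rw [abs_mul, Finset.abs_prod]
    exact mul_le_mul (hMh _) (Finset.prod_le_prod (fun i _ => abs_nonneg _) fun i _ => hM i _)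
      (Finset.prod_nonneg fun i _ => abs_nonneg _) ((abs_nonneg _).trans (hMh (S.restrict z)))
  set g : (↥(S \ C) → ℝ) × (B1Eq324BenfattoLemma.Site d → ℝ) → ℝ := fun q => G q.2 with hg
  have hgm : Measurable g := hGm.comp measurable_snd
  have hgb : ∀ q, |g q| ≤ Mh * ∏ i, M i := fun q => hGb q.2
  have htower := integral_condField_eq_integral_condField_union hα hβ C (S \ C) Finset.sdiff_disjoint zbar hgm hgb
  simp only [hg, hSsplit] at htower
  -- LHS = ∫ G d(condField C zbar)
  have hL : ∫ z, h (S.restrict z) * ∏ i, f i (S.restrict z, fun t : Ω i => z t) ∂condField d α β C zbar = ∫ z, G z ∂condField d α β C zbar := rfl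
  rw [hL, htower]
  refine integral_congr_ae (Filter.Eventually.of_forall fun ξ => ?_)
  -- inside: `z|_S = ξ|_S` a.s., then independence
  have hin : ∫ z, G z ∂condField d α β S ξ = ∫ z, h (S.restrict ξ) * ∏ i, f i (S.restrict ξ, fun t : Ω i => z t) ∂condField d α β S ξ := by
    refine integral_congr_ae ?_
    filter_upwards [condField_ae_eqOn hα hβ S ξ] with z hz
    have hres : S.restrict z = S.restrict ξ := funext fun c => hz c c.2
    simp only [hG, hres]
  show ∫ z, G z ∂condField d α β S ξ = h (S.restrict ξ) * ∏ i, ∫ z, f i (S.restrict ξ, fun t : Ω i => z t) ∂condField d α β S ξ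
  rw [hin, integral_const_mul]
  congr 1
  exact (iIndepFun_condField_of_enclosed hα hβ S hΩS hΩ hdisj ξ).integral_fun_prod_comp
    (fun i => (hXm i).aemeasurable) fun i => ((hf i).comp (measurable_const.prodMk measurable_id)).aestronglyMeasurable

end Factorisation

/-! ## §2  (5.13)/(5.36): the product over boxes under `P̄` -/

section Boxes

variable {s D : ℕ} {κ : ℝ} {a : Coef d} {J I : Finset (B1Eq324BenfattoLemma.Site d)} {L w : ℕ} {γ b A : ℝ}

/-- **(5.13)/(5.36) FOR THE PRODUCT OVER BOXES UNDER `P̄ = P̂₀(·|z̄_C)` — THE FACTORISATION IDENTITY WITH A CONDITIONING SET.**  For the corridor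
network `Γ₁ = corridors L w B` (`L, w ≥ 1`), ANY finite `C` (print: `d(C, J) ≥ b³`; here arbitrary — its sites are conditioned, never integrated),
`P̄ = condField C z̄`, inner measure `P̂₀(·|ξ_{C∪Γ₁}) = condField (C ∪ Γ₁) ξ`, cut-offs `χ^{Γ₁}_{γb}`, `χ^□_b`, `χ^{out}_b` and ANY per-box weights `W_□`
reading `□` only, measurable and bounded on the support of the box cut-offs:
`∫ χ^{Γ₁}_{γb} e^{H_{Γ₁}}·χ^{out}_b·Π_{□∈B}(χ^{Γ₁(□)}_{γb} χ^□_b e^{W_□}) dP̄ = ∫ χ^{Γ₁}_{γb}(ξ) e^{H_{Γ₁}(ξ)}·[∫ χ^{out}_b dP̂₀(·|ξ_{C∪Γ₁})]·Π_□[∫ χ^{Γ₁(□)}_{γb} χ^□_b e^{W_□}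
dP̂₀(·|ξ_{C∪Γ₁})] dP̄(ξ)` — print's (5.36) set-up «We start from (5.13)» for `P̄`.  Mechanism: §1 with `S = C ∪ Γ₁`, the blocks `out ∖ C`, `(□′∪Γ₂(□)) ∖ C`
(enclosed by `C ∪ Γ₁`), observables read through `glue (C ∪ Γ₁)`, and `z_{C∪Γ₁} = ξ_{C∪Γ₁}` a.s. to remove the gluing.
[cite: BenfattoEtAl1978, §5 (5.13) p.155, (5.36) p.159] -/
theorem integral_boxes_factorise_eq_cond (hα : 0 < α) (hβ : 0 < β) (hκ : 0 < κ) (hJ : CoefSupportedIn a J) (hA0 : 0 ≤ A)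
    (C : Finset (B1Eq324BenfattoLemma.Site d)) (zbar : B1Eq324BenfattoLemma.Site d → ℝ)
    (hA : ∀ p ∈ Finset.Icc 1 s, ∀ (Δ : Fin p → B1Eq324BenfattoLemma.Site d), (∀ i, Δ i ∈ J) →
      ∀ n ∈ admissible p D, |a p Δ n| ≤ A)
    (hJI : J ⊆ I) (hL : 0 < L) (hw : 1 ≤ w) (B : Finset (B1Eq324BenfattoLemma.Site d)) (hγ : γ ≤ 1) (hb : 1 ≤ b)
    (W : B1Eq324BenfattoLemma.Site d → (B1Eq324BenfattoLemma.Site d → ℝ) → ℝ)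
    (hWdep : ∀ m, ∀ z z' : B1Eq324BenfattoLemma.Site d → ℝ, (∀ x ∈ box L m, z x = z' x) → W m z = W m z')
    (hWm : ∀ m, Measurable (W m)) {K : ℝ}
    (hWb : ∀ m, ∀ z : B1Eq324BenfattoLemma.Site d → ℝ, (∀ x ∈ J, x ∈ box L m → |z x| ≤ b) → |W m z| ≤ K) :
    ∫ z, (smallFieldOn (corridors L w B : Set (B1Eq324BenfattoLemma.Site d)) I (γ * b)).indicator (fun _ => (1 : ℝ)) z *
          Real.exp (hamiltonian s D κ a (corridors L w B) z) *
        ((smallFieldOn (out L B) I b).indicator (fun _ => (1 : ℝ)) z *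
          ∏ m ∈ B, (smallFieldOn (frame1 L w m : Set (B1Eq324BenfattoLemma.Site d)) I (γ * b)).indicator (fun _ => (1 : ℝ)) z *
              (smallFieldOn (shrink L m w : Set (B1Eq324BenfattoLemma.Site d)) I b).indicator (fun _ => (1 : ℝ)) z * Real.exp (W m z)) ∂condField d α β C zbar
      = ∫ ξ, (smallFieldOn (corridors L w B : Set (B1Eq324BenfattoLemma.Site d)) I (γ * b)).indicator (fun _ => (1 : ℝ)) ξ *
          Real.exp (hamiltonian s D κ a (corridors L w B) ξ) *
        ((∫ z, (smallFieldOn (out L B) I b).indicator (fun _ => (1 : ℝ)) z ∂condField d α β (C ∪ corridors L w B) ξ) *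
          ∏ m ∈ B, ∫ z, (smallFieldOn (frame1 L w m : Set (B1Eq324BenfattoLemma.Site d)) I (γ * b)).indicator (fun _ => (1 : ℝ)) z *
              (smallFieldOn (shrink L m w : Set (B1Eq324BenfattoLemma.Site d)) I b).indicator (fun _ => (1 : ℝ)) z *
              Real.exp (W m z) ∂condField d α β (C ∪ corridors L w B) ξ) ∂condField d α β C zbar := by
  classical
  haveI : IsProbabilityMeasure (condField d α β C zbar) := isProbabilityMeasure_condField hα hβ C zbar
  set Γ : Finset (B1Eq324BenfattoLemma.Site d) := corridors L w B with hΓ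
  set S : Finset (B1Eq324BenfattoLemma.Site d) := C ∪ Γ with hS
  have hΓS : Γ ⊆ S := Finset.subset_union_right
  have hCS : C ⊆ S := Finset.subset_union_left
  -- the regions: the far region and the insides `□′∪Γ₂(□_m)` of the tesserae of `B`
  set R : Option B → Set (B1Eq324BenfattoLemma.Site d) :=
    fun i => i.elim (out L B) fun m => ((shrink L (m : B1Eq324BenfattoLemma.Site d) w : Finset (B1Eq324BenfattoLemma.Site d)) :
      Set (B1Eq324BenfattoLemma.Site d)) with hR
  set Ω : Option B → Set (B1Eq324BenfattoLemma.Site d) := fun i => R i \ (C : Set (B1Eq324BenfattoLemma.Site d)) with hΩ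
  -- the observables, as functions of the full configuration
  set Fobs : Option B → (B1Eq324BenfattoLemma.Site d → ℝ) → ℝ := fun i z =>
    i.elim ((smallFieldOn (out L B) I b).indicator (fun _ => (1 : ℝ)) z) fun m =>
      (smallFieldOn (frame1 L w (m : B1Eq324BenfattoLemma.Site d) : Set (B1Eq324BenfattoLemma.Site d)) I (γ * b)).indicator
          (fun _ => (1 : ℝ)) z *
        (smallFieldOn (shrink L (m : B1Eq324BenfattoLemma.Site d) w : Set (B1Eq324BenfattoLemma.Site d)) I b).indicator (fun _ => (1 : ℝ)) z *
        Real.exp (W (m : B1Eq324BenfattoLemma.Site d) z) with hFobs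
  set Hpre : (B1Eq324BenfattoLemma.Site d → ℝ) → ℝ := fun z =>
    (smallFieldOn (Γ : Set (B1Eq324BenfattoLemma.Site d)) I (γ * b)).indicator (fun _ => (1 : ℝ)) z *
      Real.exp (hamiltonian s D κ a Γ z) with hHpre
  set x0 : ((∅ : Set (B1Eq324BenfattoLemma.Site d)) → ℝ) := fun _ => 0 with hx0
  set h : (S → ℝ) → ℝ := fun y => Hpre (glue S ∅ y x0) with hh
  set f : (i : Option B) → (S → ℝ) × ((Ω i) → ℝ) → ℝ := fun i q => Fobs i (glue S (Ω i) q.1 q.2) with hf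
  -- (F1)/(F2): the observables read only `Γ` and their region
  have hF1 : ∀ z, h (S.restrict z) = Hpre z := by
    intro z
    have hagree : ∀ x ∈ (Γ : Set (B1Eq324BenfattoLemma.Site d)), glue S ∅ (S.restrict z) x0 x = z x := fun x hx => by
      rw [glue_apply_of_mem _ _ (hΓS (Finset.mem_coe.mp hx))]
      rfl
    simp only [hh, hHpre]
    rw [indicator_smallFieldOn_congr I (γ * b) hagree, hamiltonian_congr_eqOn Γ (fun x hx => hagree x (Finset.mem_coe.mpr hx))]
  -- a site of a region is in the block (off `C`) or in `S ⊇ C`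
  have hsplit : ∀ i x, x ∈ R i → x ∈ S ∨ x ∈ Ω i := by
    intro i x hx
    by_cases hxC : x ∈ C
    · exact Or.inl (hCS hxC)
    · exact Or.inr ⟨hx, fun h => hxC (Finset.mem_coe.mp h)⟩
  have hF2 : ∀ i z, Fobs i (glue S (Ω i) (S.restrict z) (fun t : Ω i => z t)) = Fobs i z := by
    rintro (_ | m) z
    · simp only [hFobs, Option.elim]
      exact indicator_smallFieldOn_congr I b fun x hx => glue_restrict_apply z (hsplit none x hx)
    · simp only [hFobs, Option.elim]
      refine boxObs_congr I γ b L w (m : B1Eq324BenfattoLemma.Site d) (hWdep (m : B1Eq324BenfattoLemma.Site d)) fun x hx =>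
        glue_restrict_apply z ?_
      by_cases hxs : x ∈ shrink L (m : B1Eq324BenfattoLemma.Site d) w
      · exact hsplit (some m) x (Finset.mem_coe.mpr hxs)
      · left
        refine hΓS (frame1_subset_corridors L w m.2 ?_)
        rw [frame1]
        exact Finset.mem_sdiff.mpr ⟨hx, hxs⟩
  -- measurability and bounds
  have hHpre_m : Measurable Hpre :=
    (measurable_indicator_smallFieldOn _ I (γ * b)).mul (measurable_hamiltonian Γ).exp
  have hFobs_m : ∀ i, Measurable (Fobs i) := by
    rintro (_ | m)
    · exact measurable_indicator_smallFieldOn _ I b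
    · exact ((measurable_indicator_smallFieldOn _ I (γ * b)).mul (measurable_indicator_smallFieldOn _ I b)).mul
        (hWm (m : B1Eq324BenfattoLemma.Site d)).exp
  have hpair : Measurable fun y : S → ℝ => (y, x0) := measurable_id.prodMk measurable_const
  have hh_m : Measurable h := hHpre_m.comp ((measurable_glue₂ S ∅).comp hpair)
  have hf_m : ∀ i, Measurable (f i) := fun i => (hFobs_m i).comp (measurable_glue₂ S (Ω i))
  have hh_b : ∀ y, |h y| ≤ Real.exp (s1Const s D d κ * A * b ^ D * Γ.card) := fun y =>
    abs_corridorObs_le hκ hJ hA0 hA hJI hγ hb Γ _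
  set M : Option B → ℝ := fun i => i.elim 1 fun _ => Real.exp K with hM
  have hf_b : ∀ i q, |f i q| ≤ M i := by
    rintro (_ | m) q
    · simp only [hf, hFobs, hM, Option.elim]
      rw [abs_of_nonneg (indicator_smallFieldOn_mem_Icc _ I b _).1]
      exact (indicator_smallFieldOn_mem_Icc _ I b _).2
    · simp only [hf, hFobs, hM, Option.elim]
      exact abs_boxObs_le hJI hγ (zero_le_one.trans hb) (m : B1Eq324BenfattoLemma.Site d) (hWb (m : B1Eq324BenfattoLemma.Site d)) _
  -- the geometry of the regions
  have hRΓ : ∀ i, ∀ z ∈ R i, z ∉ Γ := by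
    rintro (_ | m) z hz
    · exact not_mem_corridors_of_mem_out hz
    · exact fun hzΓ => Finset.disjoint_left.mp (disjoint_corridors_shrink hL w B (m : B1Eq324BenfattoLemma.Site d)) hzΓ
        (Finset.mem_coe.mp hz)
  have hΩS : ∀ i, ∀ z ∈ Ω i, z ∉ S := by
    intro i z hz hzS
    rcases Finset.mem_union.mp hzS with hzC | hzΓ
    · exact hz.2 (Finset.mem_coe.mpr hzC)
    · exact hRΓ i z hz.1 hzΓ
  have hRenc : ∀ i, ∀ z ∈ R i, ∀ μ : Fin d,
      (z + unitVec μ ∈ R i ∨ z + unitVec μ ∈ Γ) ∧ (z - unitVec μ ∈ R i ∨ z - unitVec μ ∈ Γ) := by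
    rintro (_ | m)
    · exact out_enclosed hw B
    · exact shrink_enclosed hw (m : B1Eq324BenfattoLemma.Site d) (frame1_subset_corridors L w m.2)
  have hstep : ∀ i y, (y ∈ R i ∨ y ∈ Γ) → (y ∈ Ω i ∨ y ∈ S) := by
    intro i y hy
    rcases hy with hy | hy
    · rcases hsplit i y hy with h1 | h2
      · exact Or.inr h1
      · exact Or.inl h2
    · exact Or.inr (hΓS hy)
  have hΩenc : ∀ i, ∀ z ∈ Ω i, ∀ μ : Fin d,
      (z + unitVec μ ∈ Ω i ∨ z + unitVec μ ∈ S) ∧ (z - unitVec μ ∈ Ω i ∨ z - unitVec μ ∈ S) := fun i z hz μ =>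
    ⟨hstep i _ (hRenc i z hz.1 μ).1, hstep i _ (hRenc i z hz.1 μ).2⟩
  have hdisjR : ∀ i j, i ≠ j → Disjoint (R i) (R j) := by
    have hos : ∀ m : B, Disjoint (out L B) (((shrink L (m : B1Eq324BenfattoLemma.Site d) w : Finset (B1Eq324BenfattoLemma.Site d)) :
        Set (B1Eq324BenfattoLemma.Site d))) := by
      intro m
      rw [Set.disjoint_left]
      intro z hz hzs
      exact hz (m : B1Eq324BenfattoLemma.Site d) m.2 (shrink_subset_box L _ w (Finset.mem_coe.mp hzs))
    rintro (_ | m) (_ | m') hne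
    · exact absurd rfl hne
    · exact hos m'
    · exact (hos m).symm
    · simp only [hR, Option.elim]
      rw [Finset.disjoint_coe]
      exact disjoint_shrink hL (fun h => hne (by rw [Subtype.ext h])) w w
  have hdisj : ∀ i j, i ≠ j → Disjoint (Ω i) (Ω j) := fun i j hne =>
    Set.disjoint_of_subset_left Set.sdiff_subset (Set.disjoint_of_subset_right Set.sdiff_subset (hdisjR i j hne))
  -- the integrand as `h(z|Γ)·Π_i f_i(z|Γ, z|Ω_i)`
  set G : (B1Eq324BenfattoLemma.Site d → ℝ) → ℝ := fun z => Hpre z * ∏ i, Fobs i z with hG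
  have hGeq' : ∀ z, G z = h (S.restrict z) * ∏ i, f i (S.restrict z, fun t : Ω i => z t) := by
    intro z
    simp only [hG, hf]
    rw [hF1 z]
    congr 1
    exact Finset.prod_congr rfl fun i _ => (hF2 i z).symm
  have hGstated : ∀ z, (smallFieldOn (Γ : Set (B1Eq324BenfattoLemma.Site d)) I (γ * b)).indicator (fun _ => (1 : ℝ)) z *
          Real.exp (hamiltonian s D κ a Γ z) *
        ((smallFieldOn (out L B) I b).indicator (fun _ => (1 : ℝ)) z *
          ∏ m ∈ B, (smallFieldOn (frame1 L w m : Set (B1Eq324BenfattoLemma.Site d)) I (γ * b)).indicator (fun _ => (1 : ℝ)) z *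
              (smallFieldOn (shrink L m w : Set (B1Eq324BenfattoLemma.Site d)) I b).indicator (fun _ => (1 : ℝ)) z * Real.exp (W m z))
      = G z := by
    intro z
    simp only [hG, hHpre, hFobs]
    rw [Fintype.prod_option]
    simp only [Option.elim]
    rw [Finset.prod_coe_sort B (fun m => (smallFieldOn (frame1 L w m : Set (B1Eq324BenfattoLemma.Site d)) I (γ * b)).indicator
        (fun _ => (1 : ℝ)) z * (smallFieldOn (shrink L m w : Set (B1Eq324BenfattoLemma.Site d)) I b).indicator (fun _ => (1 : ℝ)) z *
        Real.exp (W m z))]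
  -- (5.13)
  have h513 := integral_condField_prefactor_mul_prod_eq₂ hα hβ C S hCS zbar hΩS hΩenc hdisj h hh_m hh_b f hf_m hf_b
  -- the inner integrals in glue-free form, a.s. under `P̄_ξ`
  have hinner : ∀ ξ i, ∫ z, f i (S.restrict ξ, fun t : Ω i => z t) ∂condField d α β S ξ = ∫ z, Fobs i z ∂condField d α β S ξ := by
    intro ξ i
    refine integral_congr_ae ?_
    filter_upwards [condField_ae_eqOn hα hβ S ξ] with z hz
    have hres : S.restrict ξ = S.restrict z := by
      funext c
      exact (hz c c.2).symm
    simp only [hf]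
    rw [hres]
    exact hF2 i z
  have hRHS : ∀ ξ, (smallFieldOn (Γ : Set (B1Eq324BenfattoLemma.Site d)) I (γ * b)).indicator (fun _ => (1 : ℝ)) ξ *
          Real.exp (hamiltonian s D κ a Γ ξ) *
        ((∫ z, (smallFieldOn (out L B) I b).indicator (fun _ => (1 : ℝ)) z ∂condField d α β S ξ) *
          ∏ m ∈ B, ∫ z, (smallFieldOn (frame1 L w m : Set (B1Eq324BenfattoLemma.Site d)) I (γ * b)).indicator (fun _ => (1 : ℝ)) z *
              (smallFieldOn (shrink L m w : Set (B1Eq324BenfattoLemma.Site d)) I b).indicator (fun _ => (1 : ℝ)) z *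
              Real.exp (W m z) ∂condField d α β S ξ)
      = h (S.restrict ξ) * ∏ i, (∫ z, f i (S.restrict ξ, fun t : Ω i => z t) ∂condField d α β S ξ) := by
    intro ξ
    rw [hF1 ξ, Fintype.prod_option, hinner ξ none, Finset.prod_congr rfl fun m _ => hinner ξ (some m)]
    have hcoe := Finset.prod_coe_sort B (fun m => ∫ z, (smallFieldOn (frame1 L w m : Set (B1Eq324BenfattoLemma.Site d)) I (γ * b)).indicator
        (fun _ => (1 : ℝ)) z * (smallFieldOn (shrink L m w : Set (B1Eq324BenfattoLemma.Site d)) I b).indicator (fun _ => (1 : ℝ)) z *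
        Real.exp (W m z) ∂condField d α β S ξ)
    rw [← hcoe]
    rfl
  calc _ = ∫ z, G z ∂condField d α β C zbar := integral_congr_ae (Filter.Eventually.of_forall hGstated)
    _ = ∫ z, h (S.restrict z) * ∏ i, f i (S.restrict z, fun t : Ω i => z t) ∂condField d α β C zbar :=
        integral_congr_ae (Filter.Eventually.of_forall hGeq')
    _ = _ := h513
    _ = _ := (integral_congr_ae (Filter.Eventually.of_forall hRHS)).symm


end Boxes

/-! ## §3  The upper pavement step under `P̄` -/

section Upper

variable {s D : ℕ} {κ : ℝ} {a : Coef d} {J I : Finset (B1Eq324BenfattoLemma.Site d)} {L w v : ℕ}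
  {B : Finset (B1Eq324BenfattoLemma.Site d)} {γ b A : ℝ}

/-- kernel: the conditional expectation of an observable bounded by `C ≥ 0` is bounded by `C`. [folklore] -/
private theorem abs_integral_condField_le' (hα : 0 < α) (hβ : 0 < β) (Γ : Finset (B1Eq324BenfattoLemma.Site d)) (ξ : B1Eq324BenfattoLemma.Site d → ℝ)
    {φ : (B1Eq324BenfattoLemma.Site d → ℝ) → ℝ} {M : ℝ} (hφ : ∀ z, |φ z| ≤ M) : |∫ z, φ z ∂condField d α β Γ ξ| ≤ M := by
  haveI := isProbabilityMeasure_condField hα hβ Γ ξ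
  have h := norm_integral_le_of_norm_le_const (μ := condField d α β Γ ξ) (f := φ) (C := M)
    (ae_of_all _ fun z => by rw [Real.norm_eq_abs]; exact hφ z)
  rwa [probReal_univ, mul_one, Real.norm_eq_abs] at h

/-- **The product-over-boxes integrand is integrable under any finite measure** (bounded and measurable; `…Sect5Eq515.integrable_boxes_integrand` is the
case `P̂₀`). [cite: BenfattoEtAl1978, (5.13) p.155, (5.36) p.159] -/
theorem integrable_boxes_integrand_of (hκ : 0 < κ) (hJ : CoefSupportedIn a J) (hA0 : 0 ≤ A)
    (hA : ∀ p ∈ Finset.Icc 1 s, ∀ (Δ : Fin p → B1Eq324BenfattoLemma.Site d), (∀ i, Δ i ∈ J) →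
      ∀ n ∈ admissible p D, |a p Δ n| ≤ A)
    (hJI : J ⊆ I) (B : Finset (B1Eq324BenfattoLemma.Site d)) (hγ : γ ≤ 1) (hb : 1 ≤ b)
    (W : B1Eq324BenfattoLemma.Site d → (B1Eq324BenfattoLemma.Site d → ℝ) → ℝ) (hWm : ∀ m, Measurable (W m)) {K : ℝ}
    (hWb : ∀ m, ∀ z : B1Eq324BenfattoLemma.Site d → ℝ, (∀ x ∈ J, x ∈ box L m → |z x| ≤ b) → |W m z| ≤ K)
    (μ : Measure (B1Eq324BenfattoLemma.Site d → ℝ)) [IsFiniteMeasure μ] :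
    Integrable (fun z => (smallFieldOn (corridors L w B : Set (B1Eq324BenfattoLemma.Site d)) I (γ * b)).indicator (fun _ => (1 : ℝ)) z *
          Real.exp (hamiltonian s D κ a (corridors L w B) z) *
        ((smallFieldOn (out L B) I b).indicator (fun _ => (1 : ℝ)) z *
          ∏ m ∈ B, (smallFieldOn (frame1 L w m : Set (B1Eq324BenfattoLemma.Site d)) I (γ * b)).indicator (fun _ => (1 : ℝ)) z *
              (smallFieldOn (shrink L m w : Set (B1Eq324BenfattoLemma.Site d)) I b).indicator (fun _ => (1 : ℝ)) z * Real.exp (W m z))) μ := by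
  refine Integrable.of_bound ?_ (Real.exp (s1Const s D d κ * A * b ^ D * (corridors L w B).card) * (1 * ∏ _m ∈ B, Real.exp K))
    (ae_of_all _ fun z => ?_)
  · refine (((measurable_indicator_smallFieldOn _ I (γ * b)).mul (measurable_hamiltonian _).exp).mul
      ((measurable_indicator_smallFieldOn _ I b).mul (Finset.measurable_prod _ fun m _ => ?_))).aestronglyMeasurable
    exact ((measurable_indicator_smallFieldOn _ I (γ * b)).mul (measurable_indicator_smallFieldOn _ I b)).mul (hWm m).exp
  · rw [Real.norm_eq_abs, abs_mul]
    refine mul_le_mul (abs_corridorObs_le hκ hJ hA0 hA hJI hγ hb _ z) ?_ (abs_nonneg _) (Real.exp_pos _).le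
    rw [abs_mul, Finset.abs_prod]
    refine mul_le_mul ?_ (Finset.prod_le_prod (fun m _ => abs_nonneg _)
      fun m _ => abs_boxObs_le hJI hγ (zero_le_one.trans hb) m (hWb m) z) (Finset.prod_nonneg fun m _ => abs_nonneg _) zero_le_one
    rw [abs_of_nonneg (indicator_smallFieldOn_mem_Icc _ I b z).1]
    exact (indicator_smallFieldOn_mem_Icc _ I b z).2

/-- **On the prefactor's support the box factor is a set integral, under `P̂₀(·|ξ_{C∪Γ₁})`** (the corridor coordinates are `ξ`'s a.s.).
[cite: BenfattoEtAl1978, (5.13)–(5.15) p.155, (5.36) p.159] -/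
theorem boxFactor_eq_setIntegral_cond (hα : 0 < α) (hβ : 0 < β) (C : Finset (B1Eq324BenfattoLemma.Site d)) {m : B1Eq324BenfattoLemma.Site d}
    (hm : m ∈ B) (W : (B1Eq324BenfattoLemma.Site d → ℝ) → ℝ) {ξ : B1Eq324BenfattoLemma.Site d → ℝ}
    (hξ : ξ ∈ smallFieldOn (corridors L w B : Set (B1Eq324BenfattoLemma.Site d)) I (γ * b)) :
    ∫ z, (smallFieldOn (frame1 L w m : Set (B1Eq324BenfattoLemma.Site d)) I (γ * b)).indicator (fun _ => (1 : ℝ)) z *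
        (smallFieldOn (shrink L m w : Set (B1Eq324BenfattoLemma.Site d)) I b).indicator (fun _ => (1 : ℝ)) z * Real.exp (W z)
        ∂condField d α β (C ∪ corridors L w B) ξ
      = ∫ z in smallFieldOn (shrink L m w : Set (B1Eq324BenfattoLemma.Site d)) I b, Real.exp (W z) ∂condField d α β (C ∪ corridors L w B) ξ := by
  have hsub : (frame1 L w m : Set (B1Eq324BenfattoLemma.Site d)) ⊆ (corridors L w B : Set (B1Eq324BenfattoLemma.Site d)) :=
    Finset.coe_subset.mpr (frame1_subset_corridors L w hm)
  have hξ1 : ξ ∈ smallFieldOn (frame1 L w m : Set (B1Eq324BenfattoLemma.Site d)) I (γ * b) := smallFieldOn_mono hsub I (γ * b) hξ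
  rw [← integral_indicator (measurableSet_smallFieldOn _ I b)]
  refine integral_congr_ae ?_
  filter_upwards [condField_ae_eqOn hα hβ (C ∪ corridors L w B) ξ] with z hz
  have hz1 : z ∈ smallFieldOn (frame1 L w m : Set (B1Eq324BenfattoLemma.Site d)) I (γ * b) := by
    intro x hx
    rw [hz x (Finset.mem_union_right C (Finset.mem_coe.mp (hsub hx)))]
    exact hξ1 x hx
  rw [Set.indicator_of_mem hz1, one_mul]
  by_cases hzS : z ∈ smallFieldOn (shrink L m w : Set (B1Eq324BenfattoLemma.Site d)) I b
  · rw [Set.indicator_of_mem hzS, Set.indicator_of_mem hzS, one_mul]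
  · rw [Set.indicator_of_notMem hzS, Set.indicator_of_notMem hzS, zero_mul]

/-- **THE UPPER PAVEMENT STEP UNDER `P̄ = P̂₀(·|z̄_C)` ((5.36), `C ≠ ∅`)** — p. 159, *"(4.6) is obtained by simple modifications of (4.7). We start from
(5.13), then assuming |z_Δ| ≦ b(1+d(Δ,I)) ∀Δ ∈ C: [(5.12)] ≦ ∫P̄(dz_{Γ₁})χ^{Γ₁}_b expH_{Γ₁}(Π∫P̄(dz_□|z_{Γ₁})χ^□_b)(Π∫P̄(dz_□|z_{Γ₁})expΨ_□χ^□_b) (5.36) … (5.12)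
can be bounded above by the r.h.s. of (5.35) with b replaced by γ⁻¹b"*.  PROVED for the tree's objects with the conditioning set: outer measure
`P̄ = condField C z̄` (ANY finite `C`), per-box UPPER bounds as hypotheses under the two-stage conditional law `P̂₀(·|ξ_{C∪Γ₁}) = condField (C ∪ Γ₁) ξ`
(`∫_{χ^□_b}e^{Ψ_□} ≤ e^{u_□}·∫_{χ^□_b}e^{Ψ′₁+Ψ₂}` for `ξ` with `χ^{Γ₁}_b(ξ) = 1`), all cut-offs at threshold `b`:
`∫ Π_Δχ̂^b_Δ e^{H^A_J} dP̄ ≤ exp(err₅₁₁ + err₅₃₄ + Σ_{□∈B}u_□)·∫ Π_Δχ̂^b_Δ e^{H^{A|Γ̄₁}_{J∩Γ̄₁}} dP̄` — the chain of `…PavementStep.upperPavementStep_of_setIntegral`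
with `integral_boxes_factorise_eq_cond` (§2) for the factorisation identity. [cite: BenfattoEtAl1978, §5 (5.36) p.159, (4.6) p.152] -/
theorem upperPavementStep_cond_of_setIntegral (hα : 0 < α) (hβ : 0 < β) (hκ : 0 < κ) (hJ : CoefSupportedIn a J) (hA0 : 0 ≤ A)
    (C : Finset (B1Eq324BenfattoLemma.Site d)) (zbar : B1Eq324BenfattoLemma.Site d → ℝ)
    (hA : ∀ p ∈ Finset.Icc 1 s, ∀ (Δ : Fin p → B1Eq324BenfattoLemma.Site d), (∀ i, Δ i ∈ J) →
      ∀ n ∈ admissible p D, |a p Δ n| ≤ A)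
    (hJI : J ⊆ I) (hL : 0 < L) (hw : 1 ≤ w) (hv : v ≤ w) (hB : J.image (boxIndex L) ⊆ B) (hb : 1 ≤ b)
    (u : B1Eq324BenfattoLemma.Site d → ℝ)
    (hbox : ∀ m ∈ B, ∀ ξ : B1Eq324BenfattoLemma.Site d → ℝ, ξ ∈ smallFieldOn (corridors L w B : Set (B1Eq324BenfattoLemma.Site d)) I (1 * b) →
      ∫ z in smallFieldOn (shrink L m w : Set (B1Eq324BenfattoLemma.Site d)) I b,
          Real.exp (psiBox s D κ a L w m z) ∂condField d α β (C ∪ corridors L w B) ξ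
        ≤ Real.exp (u m) * ∫ z in smallFieldOn (shrink L m w : Set (B1Eq324BenfattoLemma.Site d)) I b,
          Real.exp (psi1p s D κ a L w v m z + psi2 s D κ a L w m z) ∂condField d α β (C ∪ corridors L w B) ξ) :
    ∫ z, cutoffBoltzmann (hamiltonian s D κ a J) I b z ∂condField d α β C zbar ≤
      Real.exp (s1Const s D d κ * A * b ^ D * Real.exp (-(κ / 4 * w)) * J.card
        + s1Const s D d κ * A * b ^ D *
          (Real.exp (-(κ / 4 * w)) * (corridorsBar L w v B).card + Real.exp (-(κ / 4 * v)) * (B.card * (L : ℝ) ^ d))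
        + ∑ m ∈ B, u m) *
        ∫ z, cutoffBoltzmann (hamiltonian s D κ (restrictCoef a (corridorsBar L w v B)) (J ∩ corridorsBar L w v B)) I b z ∂condField d α β C zbar := by
  haveI : IsProbabilityMeasure (condField d α β C zbar) := isProbabilityMeasure_condField hα hβ C zbar
  set Γ : Finset (B1Eq324BenfattoLemma.Site d) := corridors L w B with hΓ
  set e511 : ℝ := s1Const s D d κ * A * b ^ D * Real.exp (-(κ / 4 * w)) * J.card with he511
  set e534 : ℝ := s1Const s D d κ * A * b ^ D *
    (Real.exp (-(κ / 4 * w)) * (corridorsBar L w v B).card + Real.exp (-(κ / 4 * v)) * (B.card * (L : ℝ) ^ d)) with he534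
  have h1b : (1 : ℝ) ≤ 1 := le_rfl
  -- the two factorised z-integrands at `γ = 1`
  set IF : (B1Eq324BenfattoLemma.Site d → ℝ) → ℝ := fun z =>
    (smallFieldOn (Γ : Set (B1Eq324BenfattoLemma.Site d)) I (1 * b)).indicator (fun _ => (1 : ℝ)) z * Real.exp (hamiltonian s D κ a Γ z) *
      ((smallFieldOn (out L B) I b).indicator (fun _ => (1 : ℝ)) z *
        ∏ m ∈ B, (smallFieldOn (frame1 L w m : Set (B1Eq324BenfattoLemma.Site d)) I (1 * b)).indicator (fun _ => (1 : ℝ)) z *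
            (smallFieldOn (shrink L m w : Set (B1Eq324BenfattoLemma.Site d)) I b).indicator (fun _ => (1 : ℝ)) z * Real.exp (psiBox s D κ a L w m z))
    with hIF
  set IG : (B1Eq324BenfattoLemma.Site d → ℝ) → ℝ := fun z =>
    (smallFieldOn (Γ : Set (B1Eq324BenfattoLemma.Site d)) I (1 * b)).indicator (fun _ => (1 : ℝ)) z * Real.exp (hamiltonian s D κ a Γ z) *
      ((smallFieldOn (out L B) I b).indicator (fun _ => (1 : ℝ)) z *
        ∏ m ∈ B, (smallFieldOn (frame1 L w m : Set (B1Eq324BenfattoLemma.Site d)) I (1 * b)).indicator (fun _ => (1 : ℝ)) z *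
            (smallFieldOn (shrink L m w : Set (B1Eq324BenfattoLemma.Site d)) I b).indicator (fun _ => (1 : ℝ)) z *
            Real.exp (psi1p s D κ a L w v m z + psi2 s D κ a L w m z))
    with hIG
  -- the ξ-side factors
  set pre : (B1Eq324BenfattoLemma.Site d → ℝ) → ℝ := fun ξ =>
    (smallFieldOn (Γ : Set (B1Eq324BenfattoLemma.Site d)) I (1 * b)).indicator (fun _ => (1 : ℝ)) ξ * Real.exp (hamiltonian s D κ a Γ ξ) with hpre
  set OUT : (B1Eq324BenfattoLemma.Site d → ℝ) → ℝ := fun ξ =>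
    ∫ z, (smallFieldOn (out L B) I b).indicator (fun _ => (1 : ℝ)) z ∂condField d α β (C ∪ Γ) ξ with hOUT
  set F : B1Eq324BenfattoLemma.Site d → (B1Eq324BenfattoLemma.Site d → ℝ) → ℝ := fun m ξ =>
    ∫ z, (smallFieldOn (frame1 L w m : Set (B1Eq324BenfattoLemma.Site d)) I (1 * b)).indicator (fun _ => (1 : ℝ)) z *
        (smallFieldOn (shrink L m w : Set (B1Eq324BenfattoLemma.Site d)) I b).indicator (fun _ => (1 : ℝ)) z *
        Real.exp (psiBox s D κ a L w m z) ∂condField d α β (C ∪ Γ) ξ with hF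
  set G : B1Eq324BenfattoLemma.Site d → (B1Eq324BenfattoLemma.Site d → ℝ) → ℝ := fun m ξ =>
    ∫ z, (smallFieldOn (frame1 L w m : Set (B1Eq324BenfattoLemma.Site d)) I (1 * b)).indicator (fun _ => (1 : ℝ)) z *
        (smallFieldOn (shrink L m w : Set (B1Eq324BenfattoLemma.Site d)) I b).indicator (fun _ => (1 : ℝ)) z *
        Real.exp (psi1p s D κ a L w v m z + psi2 s D κ a L w m z) ∂condField d α β (C ∪ Γ) ξ with hG
  have hWbF : ∀ m, ∀ z : B1Eq324BenfattoLemma.Site d → ℝ, (∀ x ∈ J, x ∈ box L m → |z x| ≤ b) →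
      |psiBox s D κ a L w m z| ≤ 2 * s1Const s D d κ * A * b ^ D * (L : ℝ) ^ d := fun m z hz => abs_psiBox_le_local hκ hJ hA0 hA hb hz
  have hWbG : ∀ m, ∀ z : B1Eq324BenfattoLemma.Site d → ℝ, (∀ x ∈ J, x ∈ box L m → |z x| ≤ b) →
      |psi1p s D κ a L w v m z + psi2 s D κ a L w m z| ≤ 8 * (s1Const s D d κ * A * b ^ D * (L : ℝ) ^ d) :=
    fun m z hz => abs_psi1p_add_psi2_le_local hκ hJ hA0 hA hb hz
  -- |z| ≤ b on J on the small-field set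
  have hzJ : ∀ z ∈ smallFieldSet I b, ∀ x ∈ J, |z x| ≤ b := fun z hz x hx => by
    have h := hz x
    rwa [distToRegion_eq_zero_of_mem (hJI hx), add_zero, mul_one] at h
  -- U1: (5.11) upwards
  have hU1pt : ∀ z, cutoffBoltzmann (hamiltonian s D κ a J) I b z ≤ Real.exp e511 * cutoffBoltzmann (hatH s D κ a L w B) I b z := by
    intro z
    simp only [cutoffBoltzmann]
    by_cases hz : z ∈ smallFieldSet I b
    · rw [Set.indicator_of_mem hz, Set.indicator_of_mem hz, ← Real.exp_add, Real.exp_le_exp]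
      have h511 := abs_Hl_le_of_range hκ hJ hA0 hA hL hB hb (hzJ z hz) (s := s) (D := D) (w := w)
      have hsplit := hamiltonian_eq_hatH_add_Hl s D κ a J L w B z
      have := (abs_le.mp h511).2
      linarith
    · rw [Set.indicator_of_notMem hz, Set.indicator_of_notMem hz, mul_zero]
  -- U2: the factorised form at `γ = 1` dominates `Π_Δχ̂_Δ e^{Ĥ}` pointwise
  have hU2pt : ∀ z, cutoffBoltzmann (hatH s D κ a L w B) I b z ≤ IF z := by
    intro z
    have hF' : cutoffBoltzmann (hatH s D κ a L w B) I b z = (smallFieldSet I b).indicator (fun _ => (1 : ℝ)) z * Real.exp (hatH s D κ a L w B z) := by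
      rw [cutoffBoltzmann]
      by_cases hz : z ∈ smallFieldSet I b
      · rw [Set.indicator_of_mem hz, Set.indicator_of_mem hz, one_mul]
      · rw [Set.indicator_of_notMem hz, Set.indicator_of_notMem hz, zero_mul]
    have hIFeq : IF z = ((smallFieldOn (Γ : Set (B1Eq324BenfattoLemma.Site d)) I (1 * b)).indicator (fun _ => (1 : ℝ)) z *
        ((smallFieldOn (out L B) I b).indicator (fun _ => (1 : ℝ)) z *
          ∏ m ∈ B, ((smallFieldOn (frame1 L w m : Set (B1Eq324BenfattoLemma.Site d)) I (1 * b)).indicator (fun _ => (1 : ℝ)) z *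
              (smallFieldOn (shrink L m w : Set (B1Eq324BenfattoLemma.Site d)) I b).indicator (fun _ => (1 : ℝ)) z))) *
        (Real.exp (hamiltonian s D κ a Γ z) * ∏ m ∈ B, Real.exp (psiBox s D κ a L w m z)) := by
      simp only [hIF]
      rw [Finset.prod_mul_distrib]
      ring
    rw [hF', hIFeq, exp_hatH_eq]
    exact mul_le_mul_of_nonneg_right (indicator_smallFieldSet_le_prod L w B I b z)
      (mul_nonneg (Real.exp_pos _).le (Finset.prod_nonneg fun m _ => (Real.exp_pos _).le))
  have hIFint : Integrable IF (condField d α β C zbar) :=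
    integrable_boxes_integrand_of hκ hJ hA0 hA hJI B h1b hb (fun m z => psiBox s D κ a L w m z) (fun m => measurable_psiBox L w m) hWbF _
  have hU12 : ∫ z, cutoffBoltzmann (hamiltonian s D κ a J) I b z ∂condField d α β C zbar ≤ Real.exp e511 * ∫ z, IF z ∂condField d α β C zbar := by
    rw [← integral_const_mul]
    refine integral_mono_of_nonneg (Filter.Eventually.of_forall fun z => ?_) (hIFint.const_mul _)
      (Filter.Eventually.of_forall fun z => (hU1pt z).trans (mul_le_mul_of_nonneg_left (hU2pt z) (Real.exp_pos _).le))
    rw [cutoffBoltzmann]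
    exact Set.indicator_nonneg (fun _ _ => (Real.exp_pos _).le) _
  -- the factorisation identity, forwards and backwards (γ = 1)
  have hfacF : ∫ z, IF z ∂condField d α β C zbar = ∫ ξ, pre ξ * (OUT ξ * ∏ m ∈ B, F m ξ) ∂condField d α β C zbar :=
    integral_boxes_factorise_eq_cond hα hβ hκ hJ hA0 C zbar hA hJI hL hw B h1b hb (fun m z => psiBox s D κ a L w m z)
      (fun m z z' h => psiBox_congr_eqOn L w m h) (fun m => measurable_psiBox L w m) hWbF
  have hfacG : ∫ z, IG z ∂condField d α β C zbar = ∫ ξ, pre ξ * (OUT ξ * ∏ m ∈ B, G m ξ) ∂condField d α β C zbar :=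
    integral_boxes_factorise_eq_cond hα hβ hκ hJ hA0 C zbar hA hJI hL hw B h1b hb (fun m z => psi1p s D κ a L w v m z + psi2 s D κ a L w m z)
      (fun m z z' h => psi1p_add_psi2_congr_eqOn L w v m h) (fun m => measurable_psi1p_add_psi2 L w v m) hWbG
  -- U3: the per-box upper bounds inside the ξ-integral
  have hpre0 : ∀ ξ, 0 ≤ pre ξ := fun ξ => mul_nonneg (indicator_smallFieldOn_mem_Icc _ I _ ξ).1 (Real.exp_pos _).le
  have hOUT0 : ∀ ξ, 0 ≤ OUT ξ := fun ξ => integral_nonneg fun z => (indicator_smallFieldOn_mem_Icc _ I b z).1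
  have hOUT1 : ∀ ξ, OUT ξ ≤ 1 := fun ξ => by
    have h := abs_integral_condField_le' hα hβ (C ∪ Γ) ξ (φ := fun z => (smallFieldOn (out L B) I b).indicator (fun _ => (1 : ℝ)) z) (M := 1)
      fun z => by rw [abs_of_nonneg (indicator_smallFieldOn_mem_Icc _ I b z).1]; exact (indicator_smallFieldOn_mem_Icc _ I b z).2
    exact (le_abs_self _).trans h
  have hboxObs0 : ∀ (m : B1Eq324BenfattoLemma.Site d) (W : (B1Eq324BenfattoLemma.Site d → ℝ) → ℝ) (z : B1Eq324BenfattoLemma.Site d → ℝ),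
      0 ≤ (smallFieldOn (frame1 L w m : Set (B1Eq324BenfattoLemma.Site d)) I (1 * b)).indicator (fun _ => (1 : ℝ)) z *
        (smallFieldOn (shrink L m w : Set (B1Eq324BenfattoLemma.Site d)) I b).indicator (fun _ => (1 : ℝ)) z * Real.exp (W z) := fun m W z =>
    mul_nonneg (mul_nonneg (indicator_smallFieldOn_mem_Icc _ I _ z).1 (indicator_smallFieldOn_mem_Icc _ I _ z).1) (Real.exp_pos _).le
  have hG0 : ∀ m ξ, 0 ≤ G m ξ := fun m ξ =>
    integral_nonneg fun z => hboxObs0 m (fun z => psi1p s D κ a L w v m z + psi2 s D κ a L w m z) z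
  have hF0 : ∀ m ξ, 0 ≤ F m ξ := fun m ξ => integral_nonneg fun z => hboxObs0 m (fun z => psiBox s D κ a L w m z) z
  have hKG : ∀ m ξ, |G m ξ| ≤ Real.exp (8 * (s1Const s D d κ * A * b ^ D * (L : ℝ) ^ d)) := fun m ξ =>
    abs_integral_condField_le' hα hβ (C ∪ Γ) ξ fun z => abs_boxObs_le hJI h1b (zero_le_one.trans hb) m (hWbG m) z
  have hbox' : ∀ m ∈ B, ∀ ξ, ξ ∈ smallFieldOn (Γ : Set (B1Eq324BenfattoLemma.Site d)) I (1 * b) → F m ξ ≤ Real.exp (u m) * G m ξ := by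
    intro m hm ξ hξ
    simp only [hF, hG]
    rw [boxFactor_eq_setIntegral_cond hα hβ C hm _ hξ, boxFactor_eq_setIntegral_cond hα hβ C hm _ hξ]
    exact hbox m hm ξ hξ
  have h3pt : ∀ ξ, pre ξ * (OUT ξ * ∏ m ∈ B, F m ξ) ≤ Real.exp (∑ m ∈ B, u m) * (pre ξ * (OUT ξ * ∏ m ∈ B, G m ξ)) := by
    intro ξ
    by_cases hξ : ξ ∈ smallFieldOn (Γ : Set (B1Eq324BenfattoLemma.Site d)) I (1 * b)
    swap
    · have hpre' : pre ξ = 0 := by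
        simp only [hpre]
        rw [Set.indicator_of_notMem hξ, zero_mul]
      rw [hpre', zero_mul, zero_mul, mul_zero]
    rw [Real.exp_sum]
    have hprod : ∏ m ∈ B, F m ξ ≤ (∏ m ∈ B, Real.exp (u m)) * ∏ m ∈ B, G m ξ := by
      rw [← Finset.prod_mul_distrib]
      exact Finset.prod_le_prod (fun m _ => hF0 m ξ) fun m hm => hbox' m hm ξ hξ
    calc pre ξ * (OUT ξ * ∏ m ∈ B, F m ξ) ≤ pre ξ * (OUT ξ * ((∏ m ∈ B, Real.exp (u m)) * ∏ m ∈ B, G m ξ)) :=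
          mul_le_mul_of_nonneg_left (mul_le_mul_of_nonneg_left hprod (hOUT0 ξ)) (hpre0 ξ)
      _ = (∏ m ∈ B, Real.exp (u m)) * (pre ξ * (OUT ξ * ∏ m ∈ B, G m ξ)) := by ring
  have hmeasG : Measurable fun ξ => pre ξ * (OUT ξ * ∏ m ∈ B, G m ξ) := by
    refine ((measurable_indicator_smallFieldOn _ I (1 * b)).mul (measurable_hamiltonian Γ).exp).mul
      ((measurable_integral_condField hα hβ (C ∪ Γ) (measurable_indicator_smallFieldOn _ I b)).mul (Finset.measurable_prod _ fun m _ => ?_))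
    exact measurable_integral_condField hα hβ (C ∪ Γ)
      (((measurable_indicator_smallFieldOn _ I (1 * b)).mul (measurable_indicator_smallFieldOn _ I b)).mul (measurable_psi1p_add_psi2 L w v m).exp)
  have hintG : Integrable (fun ξ => pre ξ * (OUT ξ * ∏ m ∈ B, G m ξ)) (condField d α β C zbar) := by
    refine Integrable.of_bound hmeasG.aestronglyMeasurable
      (Real.exp (s1Const s D d κ * A * b ^ D * Γ.card) * (1 * ∏ _m ∈ B, Real.exp (8 * (s1Const s D d κ * A * b ^ D * (L : ℝ) ^ d))))
      (ae_of_all _ fun ξ => ?_)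
    rw [Real.norm_eq_abs]
    have hp : |pre ξ| ≤ Real.exp (s1Const s D d κ * A * b ^ D * Γ.card) := abs_corridorObs_le hκ hJ hA0 hA hJI h1b hb Γ ξ
    have hrest : |OUT ξ * ∏ m ∈ B, G m ξ| ≤ 1 * ∏ _m ∈ B, Real.exp (8 * (s1Const s D d κ * A * b ^ D * (L : ℝ) ^ d)) := by
      rw [abs_mul, Finset.abs_prod, abs_of_nonneg (hOUT0 ξ)]
      exact mul_le_mul (hOUT1 ξ) (Finset.prod_le_prod (fun m _ => abs_nonneg _) fun m _ => hKG m ξ)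
        (Finset.prod_nonneg fun m _ => abs_nonneg _) zero_le_one
    calc |pre ξ * (OUT ξ * ∏ m ∈ B, G m ξ)| = |pre ξ| * |OUT ξ * ∏ m ∈ B, G m ξ| := abs_mul _ _
      _ ≤ _ := mul_le_mul hp hrest (abs_nonneg _) (Real.exp_pos _).le
  have hU3 : ∫ ξ, pre ξ * (OUT ξ * ∏ m ∈ B, F m ξ) ∂condField d α β C zbar
      ≤ Real.exp (∑ m ∈ B, u m) * ∫ ξ, pre ξ * (OUT ξ * ∏ m ∈ B, G m ξ) ∂condField d α β C zbar := by
    rw [← integral_const_mul]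
    exact integral_mono_of_nonneg (Filter.Eventually.of_forall fun ξ =>
      mul_nonneg (hpre0 ξ) (mul_nonneg (hOUT0 ξ) (Finset.prod_nonneg fun m _ => hF0 m ξ))) (hintG.const_mul _)
      (Filter.Eventually.of_forall h3pt)
  -- U4: backwards at `γ = 1`, the (5.34) error upwards
  have hU4pt : ∀ z, IG z ≤ Real.exp e534 * cutoffBoltzmann (hamiltonian s D κ a (corridorsBar L w v B)) I b z := by
    intro z
    have hIGeq : IG z = ((smallFieldOn (Γ : Set (B1Eq324BenfattoLemma.Site d)) I (1 * b)).indicator (fun _ => (1 : ℝ)) z *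
        ((smallFieldOn (out L B) I b).indicator (fun _ => (1 : ℝ)) z *
          ∏ m ∈ B, (smallFieldOn (shrink L m w : Set (B1Eq324BenfattoLemma.Site d)) I b).indicator (fun _ => (1 : ℝ)) z)) *
        (∏ m ∈ B, (smallFieldOn (frame1 L w m : Set (B1Eq324BenfattoLemma.Site d)) I (1 * b)).indicator (fun _ => (1 : ℝ)) z) *
        Real.exp (hamiltonian s D κ a Γ z + ∑ m ∈ B, (psi1p s D κ a L w v m z + psi2 s D κ a L w m z)) := by
      simp only [hIG]
      rw [Real.exp_add, Real.exp_sum, Finset.prod_mul_distrib, Finset.prod_mul_distrib]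
      ring
    rw [hIGeq, cutoffBoltzmann]
    have hP := prod_indicator_le_indicator_smallFieldSet L w B I (γ := 1) (b := b) le_rfl (zero_le_one.trans hb) z
    have hQ1 : ∏ m ∈ B, (smallFieldOn (frame1 L w m : Set (B1Eq324BenfattoLemma.Site d)) I (1 * b)).indicator (fun _ => (1 : ℝ)) z ≤ 1 :=
      Finset.prod_le_one (fun m _ => (indicator_smallFieldOn_mem_Icc _ I _ z).1) fun m _ => (indicator_smallFieldOn_mem_Icc _ I _ z).2
    have hQ0 : 0 ≤ ∏ m ∈ B, (smallFieldOn (frame1 L w m : Set (B1Eq324BenfattoLemma.Site d)) I (1 * b)).indicator (fun _ => (1 : ℝ)) z :=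
      Finset.prod_nonneg fun m _ => (indicator_smallFieldOn_mem_Icc _ I _ z).1
    by_cases hz : z ∈ smallFieldSet I b
    · rw [Set.indicator_of_mem hz, ← Real.exp_add]
      have h534 := abs_hamiltonian_corridorsBar_sub_sum_psi_le hκ hJ hA0 hA hL hv hb (hzJ z hz) (B := B) (s := s) (D := D)
      have hexp : Real.exp (hamiltonian s D κ a Γ z + ∑ m ∈ B, (psi1p s D κ a L w v m z + psi2 s D κ a L w m z))
          ≤ Real.exp (e534 + hamiltonian s D κ a (corridorsBar L w v B) z) := by
        rw [Real.exp_le_exp]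
        have := (abs_le.mp h534).1
        simp only [he534]
        linarith
      have hPQ : (smallFieldOn (Γ : Set (B1Eq324BenfattoLemma.Site d)) I (1 * b)).indicator (fun _ => (1 : ℝ)) z *
          ((smallFieldOn (out L B) I b).indicator (fun _ => (1 : ℝ)) z *
            ∏ m ∈ B, (smallFieldOn (shrink L m w : Set (B1Eq324BenfattoLemma.Site d)) I b).indicator (fun _ => (1 : ℝ)) z) *
          (∏ m ∈ B, (smallFieldOn (frame1 L w m : Set (B1Eq324BenfattoLemma.Site d)) I (1 * b)).indicator (fun _ => (1 : ℝ)) z) ≤ 1 := by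
        rw [Set.indicator_of_mem hz] at hP
        exact mul_le_one₀ hP hQ0 hQ1
      calc _ ≤ 1 * Real.exp (e534 + hamiltonian s D κ a (corridorsBar L w v B) z) :=
            mul_le_mul hPQ hexp (Real.exp_pos _).le zero_le_one
        _ = _ := by rw [one_mul]
    · rw [Set.indicator_of_notMem hz] at hP ⊢
      rw [mul_zero]
      have h0 : (smallFieldOn (Γ : Set (B1Eq324BenfattoLemma.Site d)) I (1 * b)).indicator (fun _ => (1 : ℝ)) z *
          ((smallFieldOn (out L B) I b).indicator (fun _ => (1 : ℝ)) z *
            ∏ m ∈ B, (smallFieldOn (shrink L m w : Set (B1Eq324BenfattoLemma.Site d)) I b).indicator (fun _ => (1 : ℝ)) z) = 0 :=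
        le_antisymm hP (mul_nonneg (indicator_smallFieldOn_mem_Icc _ I _ z).1 (mul_nonneg (indicator_smallFieldOn_mem_Icc _ I _ z).1
          (Finset.prod_nonneg fun m _ => (indicator_smallFieldOn_mem_Icc _ I _ z).1)))
      rw [h0, zero_mul, zero_mul]
  have hZint : Integrable (fun z => cutoffBoltzmann (hamiltonian s D κ a (corridorsBar L w v B)) I b z) (condField d α β C zbar) := by
    refine Integrable.of_bound (measurable_cutoffBoltzmann_hamiltonian a _ I b).aestronglyMeasurable
      (Real.exp (s1Const s D d κ * A * b ^ D * (corridorsBar L w v B).card)) (ae_of_all _ fun z => ?_)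
    rw [Real.norm_eq_abs, cutoffBoltzmann]
    by_cases hz : z ∈ smallFieldSet I b
    · rw [Set.indicator_of_mem hz, Real.abs_exp, Real.exp_le_exp]
      exact (le_abs_self _).trans (abs_hamiltonian_le hκ hJ hA0 hA _ hb (hzJ z hz))
    · rw [Set.indicator_of_notMem hz, abs_zero]
      exact (Real.exp_pos _).le
  have hU4 : ∫ z, IG z ∂condField d α β C zbar ≤ Real.exp e534 * ∫ z, cutoffBoltzmann (hamiltonian s D κ a (corridorsBar L w v B)) I b z ∂condField d α β C zbar := by
    rw [← integral_const_mul]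
    refine integral_mono_of_nonneg (Filter.Eventually.of_forall fun z => ?_) (hZint.const_mul _) (Filter.Eventually.of_forall hU4pt)
    exact mul_nonneg (mul_nonneg (indicator_smallFieldOn_mem_Icc _ I _ z).1 (Real.exp_pos _).le)
      (mul_nonneg (indicator_smallFieldOn_mem_Icc _ I _ z).1 (Finset.prod_nonneg fun m _ =>
        hboxObs0 m (fun z => psi1p s D κ a L w v m z + psi2 s D κ a L w m z) z))
  -- U5: the next datum
  have h5 : ∫ z, cutoffBoltzmann (hamiltonian s D κ a (corridorsBar L w v B)) I b z ∂condField d α β C zbar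
      = ∫ z, cutoffBoltzmann (hamiltonian s D κ (restrictCoef a (corridorsBar L w v B)) (J ∩ corridorsBar L w v B)) I b z ∂condField d α β C zbar :=
    integral_congr_ae (Filter.Eventually.of_forall fun z => cutoffBoltzmann_hamiltonian_eq_restrict hJ _ I b z)
  -- chain
  rw [← h5]
  calc ∫ z, cutoffBoltzmann (hamiltonian s D κ a J) I b z ∂condField d α β C zbar ≤ Real.exp e511 * ∫ z, IF z ∂condField d α β C zbar := hU12
    _ = Real.exp e511 * ∫ ξ, pre ξ * (OUT ξ * ∏ m ∈ B, F m ξ) ∂condField d α β C zbar := by rw [hfacF]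
    _ ≤ Real.exp e511 * (Real.exp (∑ m ∈ B, u m) * ∫ ξ, pre ξ * (OUT ξ * ∏ m ∈ B, G m ξ) ∂condField d α β C zbar) :=
        mul_le_mul_of_nonneg_left hU3 (Real.exp_pos _).le
    _ = Real.exp e511 * (Real.exp (∑ m ∈ B, u m) * ∫ z, IG z ∂condField d α β C zbar) := by rw [hfacG]
    _ ≤ Real.exp e511 * (Real.exp (∑ m ∈ B, u m) *
          (Real.exp e534 * ∫ z, cutoffBoltzmann (hamiltonian s D κ a (corridorsBar L w v B)) I b z ∂condField d α β C zbar)) :=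
        mul_le_mul_of_nonneg_left (mul_le_mul_of_nonneg_left hU4 (Real.exp_pos _).le) (Real.exp_pos _).le
    _ = _ := by
        rw [show e511 + e534 + ∑ m ∈ B, u m = e511 + (∑ m ∈ B, u m + e534) by ring, Real.exp_add, Real.exp_add]
        ring


end Upper

/-! ## §4  (v1.1) The upper pavement step with print's `γ` — the form the per-box supplier consumes -/

section UpperGamma

variable {s D : ℕ} {κ : ℝ} {a : Coef d} {J I : Finset (B1Eq324BenfattoLemma.Site d)} {L w v : ℕ}
  {B : Finset (B1Eq324BenfattoLemma.Site d)} {γ b A : ℝ}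

/-- **On `Π_Δχ̂^{γb}_Δ` every regional cut-off of the upper chain is `1`** (`γ ≤ 1`, `b ≥ 0`): corridor data at threshold `γb`, box interiors and the
far block at threshold `b`. [cite: BenfattoEtAl1978, (5.14) p.155, (5.36) p.159] -/
theorem indicator_smallFieldSet_le_prod_gamma (L w : ℕ) (B : Finset (B1Eq324BenfattoLemma.Site d)) (I : Finset (B1Eq324BenfattoLemma.Site d))
    (hγ : γ ≤ 1) (hb : 0 ≤ b) (z : B1Eq324BenfattoLemma.Site d → ℝ) :
    (smallFieldSet I (γ * b)).indicator (fun _ => (1 : ℝ)) z ≤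
      (smallFieldOn (corridors L w B : Set (B1Eq324BenfattoLemma.Site d)) I (γ * b)).indicator (fun _ => (1 : ℝ)) z *
        ((smallFieldOn (out L B) I b).indicator (fun _ => (1 : ℝ)) z *
          ∏ m ∈ B, ((smallFieldOn (frame1 L w m : Set (B1Eq324BenfattoLemma.Site d)) I (γ * b)).indicator (fun _ => (1 : ℝ)) z *
              (smallFieldOn (shrink L m w : Set (B1Eq324BenfattoLemma.Site d)) I b).indicator (fun _ => (1 : ℝ)) z)) := by
  have hle : γ * b ≤ b := by nlinarith
  by_cases hz : z ∈ smallFieldSet I (γ * b)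
  · have h1 : ∀ R : Set (B1Eq324BenfattoLemma.Site d), z ∈ smallFieldOn R I (γ * b) := fun R => mem_smallFieldOn_of_mem_smallFieldSet le_rfl hz
    have h2 : ∀ R : Set (B1Eq324BenfattoLemma.Site d), z ∈ smallFieldOn R I b := fun R => mem_smallFieldOn_of_mem_smallFieldSet hle hz
    rw [Set.indicator_of_mem hz, Set.indicator_of_mem (h1 _), Set.indicator_of_mem (h2 _), one_mul, one_mul]
    rw [Finset.prod_eq_one fun m _ => by rw [Set.indicator_of_mem (h1 _), Set.indicator_of_mem (h2 _), one_mul]]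
  · rw [Set.indicator_of_notMem hz]
    refine mul_nonneg (indicator_smallFieldOn_mem_Icc _ I _ z).1 (mul_nonneg (indicator_smallFieldOn_mem_Icc _ I _ z).1
      (Finset.prod_nonneg fun m _ => mul_nonneg (indicator_smallFieldOn_mem_Icc _ I _ z).1 (indicator_smallFieldOn_mem_Icc _ I _ z).1))

/-- **THE UPPER PAVEMENT STEP UNDER `P̄`, WITH PRINT'S `γ` («the r.h.s. of (5.35) with b replaced by γ⁻¹b», p. 159)** — the form the per-box
line's supplier consumes (`…Sect5PerBoxOnData.perBox_condField`, 5th conjunct, needs `γ(1 + 2d/α²) ≤ ½`): INPUT cut-offs at threshold `γb` (corridor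
data `χ^{Γ₁}_{γb}`, `χ^{Γ₁(□)}_{γb}`), box interiors and the far block at threshold `b`, OUTPUT at threshold `b`:
`∫ Π_Δχ̂^{γb}_Δ e^{H^A_J} dP̄ ≤ exp(err₅₁₁(γb) + err₅₃₄(b) + Σ_{□∈B}u_□)·∫ Π_Δχ̂^{b}_Δ e^{H^{A|Γ̄₁}_{J∩Γ̄₁}} dP̄`, `P̄ = condField C z̄` (any finite `C`; `C = ∅` is
`P̂₀` by `condField_empty`), per-box UPPER hyps `∫_{χ^□_b}e^{Ψ_□} dP̂₀(·|ξ_{C∪Γ₁}) ≤ e^{u_□}·∫_{χ^□_b}e^{Ψ′₁+Ψ₂} dP̂₀(·|ξ_{C∪Γ₁})` for `ξ` with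
`χ^{Γ₁}_{γb}(ξ) = 1`.  Same chain as `upperPavementStep_cond_of_setIntegral` (which is the case `γ = 1`). [cite: BenfattoEtAl1978, §5 (5.36) p.159, (4.6) p.152] -/
theorem upperPavementStep_cond_of_setIntegral_gamma (hα : 0 < α) (hβ : 0 < β) (hκ : 0 < κ) (hJ : CoefSupportedIn a J) (hA0 : 0 ≤ A)
    (C : Finset (B1Eq324BenfattoLemma.Site d)) (zbar : B1Eq324BenfattoLemma.Site d → ℝ)
    (hA : ∀ p ∈ Finset.Icc 1 s, ∀ (Δ : Fin p → B1Eq324BenfattoLemma.Site d), (∀ i, Δ i ∈ J) →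
      ∀ n ∈ admissible p D, |a p Δ n| ≤ A)
    (hJI : J ⊆ I) (hL : 0 < L) (hw : 1 ≤ w) (hv : v ≤ w) (hB : J.image (boxIndex L) ⊆ B) (hγ : γ ≤ 1) (hb : 1 ≤ b) (hγb : 1 ≤ γ * b)
    (u : B1Eq324BenfattoLemma.Site d → ℝ)
    (hbox : ∀ m ∈ B, ∀ ξ : B1Eq324BenfattoLemma.Site d → ℝ, ξ ∈ smallFieldOn (corridors L w B : Set (B1Eq324BenfattoLemma.Site d)) I (γ * b) →
      ∫ z in smallFieldOn (shrink L m w : Set (B1Eq324BenfattoLemma.Site d)) I b,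
          Real.exp (psiBox s D κ a L w m z) ∂condField d α β (C ∪ corridors L w B) ξ
        ≤ Real.exp (u m) * ∫ z in smallFieldOn (shrink L m w : Set (B1Eq324BenfattoLemma.Site d)) I b,
          Real.exp (psi1p s D κ a L w v m z + psi2 s D κ a L w m z) ∂condField d α β (C ∪ corridors L w B) ξ) :
    ∫ z, cutoffBoltzmann (hamiltonian s D κ a J) I (γ * b) z ∂condField d α β C zbar ≤
      Real.exp (s1Const s D d κ * A * (γ * b) ^ D * Real.exp (-(κ / 4 * w)) * J.card
        + s1Const s D d κ * A * b ^ D *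
          (Real.exp (-(κ / 4 * w)) * (corridorsBar L w v B).card + Real.exp (-(κ / 4 * v)) * (B.card * (L : ℝ) ^ d))
        + ∑ m ∈ B, u m) *
        ∫ z, cutoffBoltzmann (hamiltonian s D κ (restrictCoef a (corridorsBar L w v B)) (J ∩ corridorsBar L w v B)) I b z ∂condField d α β C zbar := by
  haveI : IsProbabilityMeasure (condField d α β C zbar) := isProbabilityMeasure_condField hα hβ C zbar
  set Γ : Finset (B1Eq324BenfattoLemma.Site d) := corridors L w B with hΓ
  set e511 : ℝ := s1Const s D d κ * A * (γ * b) ^ D * Real.exp (-(κ / 4 * w)) * J.card with he511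
  set e534 : ℝ := s1Const s D d κ * A * b ^ D *
    (Real.exp (-(κ / 4 * w)) * (corridorsBar L w v B).card + Real.exp (-(κ / 4 * v)) * (B.card * (L : ℝ) ^ d)) with he534
  have hb0 : (0 : ℝ) ≤ b := zero_le_one.trans hb
  have hγb_le : γ * b ≤ b := by nlinarith
  -- the two factorised z-integrands at `γ = 1`
  set IF : (B1Eq324BenfattoLemma.Site d → ℝ) → ℝ := fun z =>
    (smallFieldOn (Γ : Set (B1Eq324BenfattoLemma.Site d)) I (γ * b)).indicator (fun _ => (1 : ℝ)) z * Real.exp (hamiltonian s D κ a Γ z) *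
      ((smallFieldOn (out L B) I b).indicator (fun _ => (1 : ℝ)) z *
        ∏ m ∈ B, (smallFieldOn (frame1 L w m : Set (B1Eq324BenfattoLemma.Site d)) I (γ * b)).indicator (fun _ => (1 : ℝ)) z *
            (smallFieldOn (shrink L m w : Set (B1Eq324BenfattoLemma.Site d)) I b).indicator (fun _ => (1 : ℝ)) z * Real.exp (psiBox s D κ a L w m z))
    with hIF
  set IG : (B1Eq324BenfattoLemma.Site d → ℝ) → ℝ := fun z =>
    (smallFieldOn (Γ : Set (B1Eq324BenfattoLemma.Site d)) I (γ * b)).indicator (fun _ => (1 : ℝ)) z * Real.exp (hamiltonian s D κ a Γ z) *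
      ((smallFieldOn (out L B) I b).indicator (fun _ => (1 : ℝ)) z *
        ∏ m ∈ B, (smallFieldOn (frame1 L w m : Set (B1Eq324BenfattoLemma.Site d)) I (γ * b)).indicator (fun _ => (1 : ℝ)) z *
            (smallFieldOn (shrink L m w : Set (B1Eq324BenfattoLemma.Site d)) I b).indicator (fun _ => (1 : ℝ)) z *
            Real.exp (psi1p s D κ a L w v m z + psi2 s D κ a L w m z))
    with hIG
  -- the ξ-side factors
  set pre : (B1Eq324BenfattoLemma.Site d → ℝ) → ℝ := fun ξ =>
    (smallFieldOn (Γ : Set (B1Eq324BenfattoLemma.Site d)) I (γ * b)).indicator (fun _ => (1 : ℝ)) ξ * Real.exp (hamiltonian s D κ a Γ ξ) with hpre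
  set OUT : (B1Eq324BenfattoLemma.Site d → ℝ) → ℝ := fun ξ =>
    ∫ z, (smallFieldOn (out L B) I b).indicator (fun _ => (1 : ℝ)) z ∂condField d α β (C ∪ Γ) ξ with hOUT
  set F : B1Eq324BenfattoLemma.Site d → (B1Eq324BenfattoLemma.Site d → ℝ) → ℝ := fun m ξ =>
    ∫ z, (smallFieldOn (frame1 L w m : Set (B1Eq324BenfattoLemma.Site d)) I (γ * b)).indicator (fun _ => (1 : ℝ)) z *
        (smallFieldOn (shrink L m w : Set (B1Eq324BenfattoLemma.Site d)) I b).indicator (fun _ => (1 : ℝ)) z *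
        Real.exp (psiBox s D κ a L w m z) ∂condField d α β (C ∪ Γ) ξ with hF
  set G : B1Eq324BenfattoLemma.Site d → (B1Eq324BenfattoLemma.Site d → ℝ) → ℝ := fun m ξ =>
    ∫ z, (smallFieldOn (frame1 L w m : Set (B1Eq324BenfattoLemma.Site d)) I (γ * b)).indicator (fun _ => (1 : ℝ)) z *
        (smallFieldOn (shrink L m w : Set (B1Eq324BenfattoLemma.Site d)) I b).indicator (fun _ => (1 : ℝ)) z *
        Real.exp (psi1p s D κ a L w v m z + psi2 s D κ a L w m z) ∂condField d α β (C ∪ Γ) ξ with hG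
  have hWbF : ∀ m, ∀ z : B1Eq324BenfattoLemma.Site d → ℝ, (∀ x ∈ J, x ∈ box L m → |z x| ≤ b) →
      |psiBox s D κ a L w m z| ≤ 2 * s1Const s D d κ * A * b ^ D * (L : ℝ) ^ d := fun m z hz => abs_psiBox_le_local hκ hJ hA0 hA hb hz
  have hWbG : ∀ m, ∀ z : B1Eq324BenfattoLemma.Site d → ℝ, (∀ x ∈ J, x ∈ box L m → |z x| ≤ b) →
      |psi1p s D κ a L w v m z + psi2 s D κ a L w m z| ≤ 8 * (s1Const s D d κ * A * b ^ D * (L : ℝ) ^ d) :=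
    fun m z hz => abs_psi1p_add_psi2_le_local hκ hJ hA0 hA hb hz
  -- |z| ≤ b (resp. γb) on J on the small-field sets
  have hzJ : ∀ z ∈ smallFieldSet I b, ∀ x ∈ J, |z x| ≤ b := fun z hz x hx => by
    have h := hz x
    rwa [distToRegion_eq_zero_of_mem (hJI hx), add_zero, mul_one] at h
  have hzJ' : ∀ z ∈ smallFieldSet I (γ * b), ∀ x ∈ J, |z x| ≤ γ * b := fun z hz x hx => by
    have h := hz x
    rwa [distToRegion_eq_zero_of_mem (hJI hx), add_zero, mul_one] at h
  -- U1: (5.11) upwards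
  have hU1pt : ∀ z, cutoffBoltzmann (hamiltonian s D κ a J) I (γ * b) z ≤ Real.exp e511 * cutoffBoltzmann (hatH s D κ a L w B) I (γ * b) z := by
    intro z
    simp only [cutoffBoltzmann]
    by_cases hz : z ∈ smallFieldSet I (γ * b)
    · rw [Set.indicator_of_mem hz, Set.indicator_of_mem hz, ← Real.exp_add, Real.exp_le_exp]
      have h511 := abs_Hl_le_of_range hκ hJ hA0 hA hL hB hγb (hzJ' z hz) (s := s) (D := D) (w := w)
      have hsplit := hamiltonian_eq_hatH_add_Hl s D κ a J L w B z
      have := (abs_le.mp h511).2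
      linarith
    · rw [Set.indicator_of_notMem hz, Set.indicator_of_notMem hz, mul_zero]
  -- U2: the factorised form at `γ = 1` dominates `Π_Δχ̂_Δ e^{Ĥ}` pointwise
  have hU2pt : ∀ z, cutoffBoltzmann (hatH s D κ a L w B) I (γ * b) z ≤ IF z := by
    intro z
    have hF' : cutoffBoltzmann (hatH s D κ a L w B) I (γ * b) z = (smallFieldSet I (γ * b)).indicator (fun _ => (1 : ℝ)) z *
        Real.exp (hatH s D κ a L w B z) := by
      rw [cutoffBoltzmann]
      by_cases hz : z ∈ smallFieldSet I (γ * b)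
      · rw [Set.indicator_of_mem hz, Set.indicator_of_mem hz, one_mul]
      · rw [Set.indicator_of_notMem hz, Set.indicator_of_notMem hz, zero_mul]
    have hIFeq : IF z = ((smallFieldOn (Γ : Set (B1Eq324BenfattoLemma.Site d)) I (γ * b)).indicator (fun _ => (1 : ℝ)) z *
        ((smallFieldOn (out L B) I b).indicator (fun _ => (1 : ℝ)) z *
          ∏ m ∈ B, ((smallFieldOn (frame1 L w m : Set (B1Eq324BenfattoLemma.Site d)) I (γ * b)).indicator (fun _ => (1 : ℝ)) z *
              (smallFieldOn (shrink L m w : Set (B1Eq324BenfattoLemma.Site d)) I b).indicator (fun _ => (1 : ℝ)) z))) *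
        (Real.exp (hamiltonian s D κ a Γ z) * ∏ m ∈ B, Real.exp (psiBox s D κ a L w m z)) := by
      simp only [hIF]
      rw [Finset.prod_mul_distrib]
      ring
    rw [hF', hIFeq, exp_hatH_eq]
    exact mul_le_mul_of_nonneg_right (indicator_smallFieldSet_le_prod_gamma L w B I hγ hb0 z)
      (mul_nonneg (Real.exp_pos _).le (Finset.prod_nonneg fun m _ => (Real.exp_pos _).le))
  have hIFint : Integrable IF (condField d α β C zbar) :=
    integrable_boxes_integrand_of hκ hJ hA0 hA hJI B hγ hb (fun m z => psiBox s D κ a L w m z) (fun m => measurable_psiBox L w m) hWbF _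
  have hU12 : ∫ z, cutoffBoltzmann (hamiltonian s D κ a J) I (γ * b) z ∂condField d α β C zbar ≤ Real.exp e511 * ∫ z, IF z ∂condField d α β C zbar := by
    rw [← integral_const_mul]
    refine integral_mono_of_nonneg (Filter.Eventually.of_forall fun z => ?_) (hIFint.const_mul _)
      (Filter.Eventually.of_forall fun z => (hU1pt z).trans (mul_le_mul_of_nonneg_left (hU2pt z) (Real.exp_pos _).le))
    rw [cutoffBoltzmann]
    exact Set.indicator_nonneg (fun _ _ => (Real.exp_pos _).le) _
  -- the factorisation identity, forwards and backwards (γ = 1)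
  have hfacF : ∫ z, IF z ∂condField d α β C zbar = ∫ ξ, pre ξ * (OUT ξ * ∏ m ∈ B, F m ξ) ∂condField d α β C zbar :=
    integral_boxes_factorise_eq_cond hα hβ hκ hJ hA0 C zbar hA hJI hL hw B hγ hb (fun m z => psiBox s D κ a L w m z)
      (fun m z z' h => psiBox_congr_eqOn L w m h) (fun m => measurable_psiBox L w m) hWbF
  have hfacG : ∫ z, IG z ∂condField d α β C zbar = ∫ ξ, pre ξ * (OUT ξ * ∏ m ∈ B, G m ξ) ∂condField d α β C zbar :=
    integral_boxes_factorise_eq_cond hα hβ hκ hJ hA0 C zbar hA hJI hL hw B hγ hb (fun m z => psi1p s D κ a L w v m z + psi2 s D κ a L w m z)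
      (fun m z z' h => psi1p_add_psi2_congr_eqOn L w v m h) (fun m => measurable_psi1p_add_psi2 L w v m) hWbG
  -- U3: the per-box upper bounds inside the ξ-integral
  have hpre0 : ∀ ξ, 0 ≤ pre ξ := fun ξ => mul_nonneg (indicator_smallFieldOn_mem_Icc _ I _ ξ).1 (Real.exp_pos _).le
  have hOUT0 : ∀ ξ, 0 ≤ OUT ξ := fun ξ => integral_nonneg fun z => (indicator_smallFieldOn_mem_Icc _ I b z).1
  have hOUT1 : ∀ ξ, OUT ξ ≤ 1 := fun ξ => by
    have h := abs_integral_condField_le' hα hβ (C ∪ Γ) ξ (φ := fun z => (smallFieldOn (out L B) I b).indicator (fun _ => (1 : ℝ)) z) (M := 1)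
      fun z => by rw [abs_of_nonneg (indicator_smallFieldOn_mem_Icc _ I b z).1]; exact (indicator_smallFieldOn_mem_Icc _ I b z).2
    exact (le_abs_self _).trans h
  have hboxObs0 : ∀ (m : B1Eq324BenfattoLemma.Site d) (W : (B1Eq324BenfattoLemma.Site d → ℝ) → ℝ) (z : B1Eq324BenfattoLemma.Site d → ℝ),
      0 ≤ (smallFieldOn (frame1 L w m : Set (B1Eq324BenfattoLemma.Site d)) I (γ * b)).indicator (fun _ => (1 : ℝ)) z *
        (smallFieldOn (shrink L m w : Set (B1Eq324BenfattoLemma.Site d)) I b).indicator (fun _ => (1 : ℝ)) z * Real.exp (W z) := fun m W z =>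
    mul_nonneg (mul_nonneg (indicator_smallFieldOn_mem_Icc _ I _ z).1 (indicator_smallFieldOn_mem_Icc _ I _ z).1) (Real.exp_pos _).le
  have hG0 : ∀ m ξ, 0 ≤ G m ξ := fun m ξ =>
    integral_nonneg fun z => hboxObs0 m (fun z => psi1p s D κ a L w v m z + psi2 s D κ a L w m z) z
  have hF0 : ∀ m ξ, 0 ≤ F m ξ := fun m ξ => integral_nonneg fun z => hboxObs0 m (fun z => psiBox s D κ a L w m z) z
  have hKG : ∀ m ξ, |G m ξ| ≤ Real.exp (8 * (s1Const s D d κ * A * b ^ D * (L : ℝ) ^ d)) := fun m ξ =>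
    abs_integral_condField_le' hα hβ (C ∪ Γ) ξ fun z => abs_boxObs_le hJI hγ (zero_le_one.trans hb) m (hWbG m) z
  have hbox' : ∀ m ∈ B, ∀ ξ, ξ ∈ smallFieldOn (Γ : Set (B1Eq324BenfattoLemma.Site d)) I (γ * b) → F m ξ ≤ Real.exp (u m) * G m ξ := by
    intro m hm ξ hξ
    simp only [hF, hG]
    rw [boxFactor_eq_setIntegral_cond hα hβ C hm _ hξ, boxFactor_eq_setIntegral_cond hα hβ C hm _ hξ]
    exact hbox m hm ξ hξ
  have h3pt : ∀ ξ, pre ξ * (OUT ξ * ∏ m ∈ B, F m ξ) ≤ Real.exp (∑ m ∈ B, u m) * (pre ξ * (OUT ξ * ∏ m ∈ B, G m ξ)) := by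
    intro ξ
    by_cases hξ : ξ ∈ smallFieldOn (Γ : Set (B1Eq324BenfattoLemma.Site d)) I (γ * b)
    swap
    · have hpre' : pre ξ = 0 := by
        simp only [hpre]
        rw [Set.indicator_of_notMem hξ, zero_mul]
      rw [hpre', zero_mul, zero_mul, mul_zero]
    rw [Real.exp_sum]
    have hprod : ∏ m ∈ B, F m ξ ≤ (∏ m ∈ B, Real.exp (u m)) * ∏ m ∈ B, G m ξ := by
      rw [← Finset.prod_mul_distrib]
      exact Finset.prod_le_prod (fun m _ => hF0 m ξ) fun m hm => hbox' m hm ξ hξ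
    calc pre ξ * (OUT ξ * ∏ m ∈ B, F m ξ) ≤ pre ξ * (OUT ξ * ((∏ m ∈ B, Real.exp (u m)) * ∏ m ∈ B, G m ξ)) :=
          mul_le_mul_of_nonneg_left (mul_le_mul_of_nonneg_left hprod (hOUT0 ξ)) (hpre0 ξ)
      _ = (∏ m ∈ B, Real.exp (u m)) * (pre ξ * (OUT ξ * ∏ m ∈ B, G m ξ)) := by ring
  have hmeasG : Measurable fun ξ => pre ξ * (OUT ξ * ∏ m ∈ B, G m ξ) := by
    refine ((measurable_indicator_smallFieldOn _ I (γ * b)).mul (measurable_hamiltonian Γ).exp).mul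
      ((measurable_integral_condField hα hβ (C ∪ Γ) (measurable_indicator_smallFieldOn _ I b)).mul (Finset.measurable_prod _ fun m _ => ?_))
    exact measurable_integral_condField hα hβ (C ∪ Γ)
      (((measurable_indicator_smallFieldOn _ I (γ * b)).mul (measurable_indicator_smallFieldOn _ I b)).mul (measurable_psi1p_add_psi2 L w v m).exp)
  have hintG : Integrable (fun ξ => pre ξ * (OUT ξ * ∏ m ∈ B, G m ξ)) (condField d α β C zbar) := by
    refine Integrable.of_bound hmeasG.aestronglyMeasurable
      (Real.exp (s1Const s D d κ * A * b ^ D * Γ.card) * (1 * ∏ _m ∈ B, Real.exp (8 * (s1Const s D d κ * A * b ^ D * (L : ℝ) ^ d))))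
      (ae_of_all _ fun ξ => ?_)
    rw [Real.norm_eq_abs]
    have hp : |pre ξ| ≤ Real.exp (s1Const s D d κ * A * b ^ D * Γ.card) := abs_corridorObs_le hκ hJ hA0 hA hJI hγ hb Γ ξ
    have hrest : |OUT ξ * ∏ m ∈ B, G m ξ| ≤ 1 * ∏ _m ∈ B, Real.exp (8 * (s1Const s D d κ * A * b ^ D * (L : ℝ) ^ d)) := by
      rw [abs_mul, Finset.abs_prod, abs_of_nonneg (hOUT0 ξ)]
      exact mul_le_mul (hOUT1 ξ) (Finset.prod_le_prod (fun m _ => abs_nonneg _) fun m _ => hKG m ξ)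
        (Finset.prod_nonneg fun m _ => abs_nonneg _) zero_le_one
    calc |pre ξ * (OUT ξ * ∏ m ∈ B, G m ξ)| = |pre ξ| * |OUT ξ * ∏ m ∈ B, G m ξ| := abs_mul _ _
      _ ≤ _ := mul_le_mul hp hrest (abs_nonneg _) (Real.exp_pos _).le
  have hU3 : ∫ ξ, pre ξ * (OUT ξ * ∏ m ∈ B, F m ξ) ∂condField d α β C zbar
      ≤ Real.exp (∑ m ∈ B, u m) * ∫ ξ, pre ξ * (OUT ξ * ∏ m ∈ B, G m ξ) ∂condField d α β C zbar := by
    rw [← integral_const_mul]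
    exact integral_mono_of_nonneg (Filter.Eventually.of_forall fun ξ =>
      mul_nonneg (hpre0 ξ) (mul_nonneg (hOUT0 ξ) (Finset.prod_nonneg fun m _ => hF0 m ξ))) (hintG.const_mul _)
      (Filter.Eventually.of_forall h3pt)
  -- U4: backwards at `γ = 1`, the (5.34) error upwards
  have hU4pt : ∀ z, IG z ≤ Real.exp e534 * cutoffBoltzmann (hamiltonian s D κ a (corridorsBar L w v B)) I b z := by
    intro z
    have hIGeq : IG z = ((smallFieldOn (Γ : Set (B1Eq324BenfattoLemma.Site d)) I (γ * b)).indicator (fun _ => (1 : ℝ)) z *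
        ((smallFieldOn (out L B) I b).indicator (fun _ => (1 : ℝ)) z *
          ∏ m ∈ B, (smallFieldOn (shrink L m w : Set (B1Eq324BenfattoLemma.Site d)) I b).indicator (fun _ => (1 : ℝ)) z)) *
        (∏ m ∈ B, (smallFieldOn (frame1 L w m : Set (B1Eq324BenfattoLemma.Site d)) I (γ * b)).indicator (fun _ => (1 : ℝ)) z) *
        Real.exp (hamiltonian s D κ a Γ z + ∑ m ∈ B, (psi1p s D κ a L w v m z + psi2 s D κ a L w m z)) := by
      simp only [hIG]
      rw [Real.exp_add, Real.exp_sum, Finset.prod_mul_distrib, Finset.prod_mul_distrib]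
      ring
    rw [hIGeq, cutoffBoltzmann]
    have hP := prod_indicator_le_indicator_smallFieldSet L w B I (γ := γ) (b := b) hγ hb0 z
    have hQ1 : ∏ m ∈ B, (smallFieldOn (frame1 L w m : Set (B1Eq324BenfattoLemma.Site d)) I (γ * b)).indicator (fun _ => (1 : ℝ)) z ≤ 1 :=
      Finset.prod_le_one (fun m _ => (indicator_smallFieldOn_mem_Icc _ I _ z).1) fun m _ => (indicator_smallFieldOn_mem_Icc _ I _ z).2
    have hQ0 : 0 ≤ ∏ m ∈ B, (smallFieldOn (frame1 L w m : Set (B1Eq324BenfattoLemma.Site d)) I (γ * b)).indicator (fun _ => (1 : ℝ)) z :=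
      Finset.prod_nonneg fun m _ => (indicator_smallFieldOn_mem_Icc _ I _ z).1
    by_cases hz : z ∈ smallFieldSet I b
    · rw [Set.indicator_of_mem hz, ← Real.exp_add]
      have h534 := abs_hamiltonian_corridorsBar_sub_sum_psi_le hκ hJ hA0 hA hL hv hb (hzJ z hz) (B := B) (s := s) (D := D)
      have hexp : Real.exp (hamiltonian s D κ a Γ z + ∑ m ∈ B, (psi1p s D κ a L w v m z + psi2 s D κ a L w m z))
          ≤ Real.exp (e534 + hamiltonian s D κ a (corridorsBar L w v B) z) := by
        rw [Real.exp_le_exp]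
        have := (abs_le.mp h534).1
        simp only [he534]
        linarith
      have hPQ : (smallFieldOn (Γ : Set (B1Eq324BenfattoLemma.Site d)) I (γ * b)).indicator (fun _ => (1 : ℝ)) z *
          ((smallFieldOn (out L B) I b).indicator (fun _ => (1 : ℝ)) z *
            ∏ m ∈ B, (smallFieldOn (shrink L m w : Set (B1Eq324BenfattoLemma.Site d)) I b).indicator (fun _ => (1 : ℝ)) z) *
          (∏ m ∈ B, (smallFieldOn (frame1 L w m : Set (B1Eq324BenfattoLemma.Site d)) I (γ * b)).indicator (fun _ => (1 : ℝ)) z) ≤ 1 := by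
        rw [Set.indicator_of_mem hz] at hP
        exact mul_le_one₀ hP hQ0 hQ1
      calc _ ≤ 1 * Real.exp (e534 + hamiltonian s D κ a (corridorsBar L w v B) z) :=
            mul_le_mul hPQ hexp (Real.exp_pos _).le zero_le_one
        _ = _ := by rw [one_mul]
    · rw [Set.indicator_of_notMem hz] at hP ⊢
      rw [mul_zero]
      have h0 : (smallFieldOn (Γ : Set (B1Eq324BenfattoLemma.Site d)) I (γ * b)).indicator (fun _ => (1 : ℝ)) z *
          ((smallFieldOn (out L B) I b).indicator (fun _ => (1 : ℝ)) z *
            ∏ m ∈ B, (smallFieldOn (shrink L m w : Set (B1Eq324BenfattoLemma.Site d)) I b).indicator (fun _ => (1 : ℝ)) z) = 0 :=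
        le_antisymm hP (mul_nonneg (indicator_smallFieldOn_mem_Icc _ I _ z).1 (mul_nonneg (indicator_smallFieldOn_mem_Icc _ I _ z).1
          (Finset.prod_nonneg fun m _ => (indicator_smallFieldOn_mem_Icc _ I _ z).1)))
      rw [h0, zero_mul, zero_mul]
  have hZint : Integrable (fun z => cutoffBoltzmann (hamiltonian s D κ a (corridorsBar L w v B)) I b z) (condField d α β C zbar) := by
    refine Integrable.of_bound (measurable_cutoffBoltzmann_hamiltonian a _ I b).aestronglyMeasurable
      (Real.exp (s1Const s D d κ * A * b ^ D * (corridorsBar L w v B).card)) (ae_of_all _ fun z => ?_)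
    rw [Real.norm_eq_abs, cutoffBoltzmann]
    by_cases hz : z ∈ smallFieldSet I b
    · rw [Set.indicator_of_mem hz, Real.abs_exp, Real.exp_le_exp]
      exact (le_abs_self _).trans (abs_hamiltonian_le hκ hJ hA0 hA _ hb (hzJ z hz))
    · rw [Set.indicator_of_notMem hz, abs_zero]
      exact (Real.exp_pos _).le
  have hU4 : ∫ z, IG z ∂condField d α β C zbar ≤ Real.exp e534 * ∫ z, cutoffBoltzmann (hamiltonian s D κ a (corridorsBar L w v B)) I b z ∂condField d α β C zbar := by
    rw [← integral_const_mul]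
    refine integral_mono_of_nonneg (Filter.Eventually.of_forall fun z => ?_) (hZint.const_mul _) (Filter.Eventually.of_forall hU4pt)
    exact mul_nonneg (mul_nonneg (indicator_smallFieldOn_mem_Icc _ I _ z).1 (Real.exp_pos _).le)
      (mul_nonneg (indicator_smallFieldOn_mem_Icc _ I _ z).1 (Finset.prod_nonneg fun m _ =>
        hboxObs0 m (fun z => psi1p s D κ a L w v m z + psi2 s D κ a L w m z) z))
  -- U5: the next datum
  have h5 : ∫ z, cutoffBoltzmann (hamiltonian s D κ a (corridorsBar L w v B)) I b z ∂condField d α β C zbar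
      = ∫ z, cutoffBoltzmann (hamiltonian s D κ (restrictCoef a (corridorsBar L w v B)) (J ∩ corridorsBar L w v B)) I b z ∂condField d α β C zbar :=
    integral_congr_ae (Filter.Eventually.of_forall fun z => cutoffBoltzmann_hamiltonian_eq_restrict hJ _ I b z)
  -- chain
  rw [← h5]
  calc ∫ z, cutoffBoltzmann (hamiltonian s D κ a J) I (γ * b) z ∂condField d α β C zbar ≤ Real.exp e511 * ∫ z, IF z ∂condField d α β C zbar := hU12
    _ = Real.exp e511 * ∫ ξ, pre ξ * (OUT ξ * ∏ m ∈ B, F m ξ) ∂condField d α β C zbar := by rw [hfacF]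
    _ ≤ Real.exp e511 * (Real.exp (∑ m ∈ B, u m) * ∫ ξ, pre ξ * (OUT ξ * ∏ m ∈ B, G m ξ) ∂condField d α β C zbar) :=
        mul_le_mul_of_nonneg_left hU3 (Real.exp_pos _).le
    _ = Real.exp e511 * (Real.exp (∑ m ∈ B, u m) * ∫ z, IG z ∂condField d α β C zbar) := by rw [hfacG]
    _ ≤ Real.exp e511 * (Real.exp (∑ m ∈ B, u m) *
          (Real.exp e534 * ∫ z, cutoffBoltzmann (hamiltonian s D κ a (corridorsBar L w v B)) I b z ∂condField d α β C zbar)) :=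
        mul_le_mul_of_nonneg_left (mul_le_mul_of_nonneg_left hU4 (Real.exp_pos _).le) (Real.exp_pos _).le
    _ = _ := by
        rw [show e511 + e534 + ∑ m ∈ B, u m = e511 + (∑ m ∈ B, u m + e534) by ring, Real.exp_add, Real.exp_add]
        ring



end UpperGamma

end Literature.MathematicalPhysics.QuantumFieldTheory.Balaban1983to89.B1Eq324BenfattoSect5Eq536

end
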